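import Mathlib.Order.SymmDiff
import Mathlib.Data.Finset.SymmDiff
import Mathlib.Data.Fintype.Card
import Mathlib.Algebra.BigOperators.Ring.Finset
import Mathlib.Algebra.BigOperators.Group.Finset.Basic
import Mathlib.Algebra.Group.Nat.Even
import Literature.ModelTheory.FiniteModelTheory.CFIUncoloured
import Literature.ModelTheory.FiniteModelTheory.CkEquivHomCount
import Literature.ModelTheory.FiniteModelTheory.CountingWidthParameterProofs
import Literature.Combinatorics.SimpleGraph.TreewidthDuality
import Literature.Combinatorics.SimpleGraph.TreeDecompositionRooting
import Literature.Combinatorics.SimpleGraph.ListTreeDecomposition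
import HarnessLib

/-!
# The uncoloured CFI graphs versus tree-width (Chen–Flum–Liu 2025, Cor. 12.3, Thm. 11.1): proofs

This file DISCHARGES the two named facts of `CFIUncoloured.lean` relating `C^k`-equivalence of
the uncoloured CFI graphs over `G` to the tree-width of `G`. The second one,
`ChenFlumLiu2025_ckEquiv_of_le_treewidth` (Thm. 11.1 / (12.1): `tw(G) ≥ k ≥ 1` ⇒
`Y(G) ≡_{C^k} Ỹ(G)`, via the tree-width duality theorem of Seymour–Thomas and the Robber's
strategy), is treated in the last section of the file, which has its own account of the printed
proof. The first one,
`Literature.ModelTheory.FiniteModelTheory.ChenFlumLiu2025_not_ckEquiv_of_treewidth_lt`: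

* `ChenFlumLiu2025_not_ckEquiv_of_treewidth_lt_holds` — for `k ≥ 2`, a base graph `G` on `Fin v`
  with `treewidth G < k` and an edge `e` of `G`, the untwisted CFI graph `cfiEven G` (`Y(G)`) and
  the one-twist CFI graph `cfiGraph G {e}` (`Ỹ(G) = Y^e(G)`) are NOT `C^k`-equivalent
  (`CkEquiv k`, Hella's bijective `k`-pebble game).

Source: Y. Chen, J. Flum, M. Liu, *Some remarks on the uncolored versions of the original
CFI-graphs*, arXiv:2507.01459 (2025), §12 (read: pp. 39–43 of the PDF). The printed proof of
Cor. 12.3 and how it is rendered here: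

1. **Thm. 12.1 (Dvořák 2010, Thm. 6)**: `H₁ ≢_{C^k} H₂` iff some graph `F` of tree-width `< k`
   has `hom(F, H₁) ≠ hom(F, H₂)`. Only the direction "`≡_{C^k}` ⇒ equal counts" is needed, and it
   is PROVED in the tree for the game definition of `CkEquiv`:
   `Dvorak2010.card_hom_eq_of_ckEquiv` (`CkEquivHomCount.lean`; any finite `F` with a tree
   decomposition all of whose bags have `≤ k` vertices).
2. **The test graph `F = G₂`**, the 2-subdivision of `G` (every edge `uv` becomes the path
   `u, w_{u,v}, w_{v,u}, v`): `ChenFlumLiu2025.subdiv G` on `Fin v ⊕ Dart G`, the subdivision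
   vertex `w_{u,v}` being the dart `(u, v)`. "Then `tw(G₂) = tw(G)`" (p. 39): from a rooted tree
   decomposition of `G` in list form (`exists_isRootedTD_of_treewidth_le`,
   `TreeDecompositionRooting.lean`) we build one of `G₂` with bags of size `≤ k`
   (`ChenFlumLiu2025.exists_treeDecomposition_subdiv`): for `k ≥ 3` literally the printed
   construction — keep the old bags and hang, for every edge `uv` (`u < v`), the bag
   `B₁ = {u, w_{u,v}, v}` below a bag holding `u, v` and `B₂ = {w_{u,v}, w_{v,u}, v}` below `B₁`
   (`ChenFlumLiu2025.wideTD`); for `k = 2` ("if `tw(G) = 1`, then `G` is a tree … `G₂` is a tree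
   too") the width-1 decomposition cannot keep the old bags, so we read a ROOTING of the forest
   `G` off the width-1 decomposition (every vertex has at most one neighbour entering the
   decomposition before it: `ChenFlumLiu2025.below_unique`, `vpar`, `vpar_eq_or_of_adj`) and write
   down the width-1 decomposition of the forest `G₂` along it (`ChenFlumLiu2025.narrowTD`).
   Both are presented by parent pointers and ranks (`ChenFlumLiu2025.RankedTD`, converted to the
   tree's `TreeDecomposition` by `RankedTD.toTreeDecomposition`: the tree of parent pointers is
   connected with `|ι| - 1` edges, and (T3) holds along parents).
3. **Thm. 12.2: `hom(G₂, Y(G)) > hom(G₂, Ỹ(G))`** (`ChenFlumLiu2025.card_hom_subdiv_lt`). The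
   paper sorts `Hom(G₂, Y^i(G))` by the composite `g = p ∘ f` with the projection
   `p : Y^i(G) → G₂` ((12.4), `ChenFlumLiu2025.proj`), identifies each fibre `Hom^i_g` with the
   solutions of a linear system `Eq^i_g` over `𝔽₂` (Lemma 12.5) whose homogeneous part is
   `Eq⁰_g`, so that `|Hom¹_g| ∈ {0, |Hom⁰_g|}`, and shows `Hom¹_{id} = ∅` (every variable occurs
   twice, the right-hand sides add up to `1`) while `Hom⁰_g ≠ ∅` (Example 12.4). Here the linear
   algebra is kept implicit: the DIFFERENCE of two lifts over the same `g`
   (`ChenFlumLiu2025.dsub`: `m_{u,S} - m_{u,S'} = m_{u,S ∆ S'}`, `(d,c) - (d,c') = (d, c ⊕ c')`) is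
   a lift to `Y(G)` over `g` (`isHom_dsub` — the homogeneous system) and is injective in its
   first argument (`dsub_left_injective`), so subtracting a chosen element of its own fibre maps
   `Hom(G₂, Ỹ(G))` injectively into `Hom(G₂, Y(G))`; the image misses the zero section over the
   identity (`isHom_zeroLift`, Example 12.4) because there is no lift of the identity to `Ỹ(G)`
   (`not_isHom_of_proj_eq`: the parity argument of the proof of Thm. 12.2, as
   `Σ_u |S_u| = #{darts (u,v) with bit a}`, even on the left and odd on the right).

Design notes. Homomorphisms are counted as bare functions (`Dvorak2010.IsHom`,
`Dvorak2010.card_hom_eq_card_subtype`). The hypotheses "`G` connected, `|G| ≥ 2`" of the fact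
(the paper's standing assumptions, used there only to have `tw(G) ≥ 1`) are not needed and not
used. NOT here: the equality `tw(G₂) = tw(G)` (only `≤` is needed). The converse (12.1)
(`tw(G) ≥ k ⇒ Y(G) ≡_{C^k} Ỹ(G)`, the fact `ChenFlumLiu2025_ckEquiv_of_le_treewidth`) is the
last section of this file.

## References

* [ChenFlumLiu2025] Y. Chen, J. Flum, M. Liu, *Some remarks on the uncolored versions of the
  original CFI-graphs*, arXiv:2507.01459 (2025): §12, Thm. 12.1, the graph `G₂` and its tree
  decomposition (p. 39), Thm. 12.2, Cor. 12.3, (12.4), Example 12.4, Lemma 12.5, proof of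
  Thm. 12.2 (pp. 40–43). Read via `lit read arxiv:2507.01459`.
* [Dvorak2010] Z. Dvořák, J. Graph Theory 64 (2010), Thm. 6 (proved in `CkEquivHomCount.lean`).
* [CaiFurerImmerman1992] J.-Y. Cai, M. Fürer, N. Immerman, Combinatorica 12 (1992), §6 (the
  gadgets; `CFI.lean`).
* [CyganEtAl2015] M. Cygan et al., *Parameterized Algorithms*, Springer 2015, §7.2 (rooted tree
  decompositions; the list form of `ListTreeDecomposition.lean` / `TreeDecompositionRooting.lean`).
-/

namespace Literature.ModelTheory.FiniteModelTheory

open Finset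
open scoped symmDiff

namespace ChenFlumLiu2025

variable {v : ℕ} (G : SimpleGraph (Fin v))

/-! ### The 2-subdivision `G₂` -/

/-- The darts (ordered adjacent pairs) of `G`, in the form used by `CFIVertex`. [folklore] -/
abbrev Dart : Type := {p : Fin v × Fin v // G.Adj p.1 p.2}

variable {G} in
/-- The reverse of a dart. [folklore] -/
def Dart.rev (d : Dart G) : Dart G := ⟨(d.1.2, d.1.1), d.2.symm⟩

variable {G} in
/-- Reversal is an involution. [folklore] -/
@[simp] theorem Dart.rev_rev (d : Dart G) : d.rev.rev = d := by
  obtain ⟨⟨a, b⟩, h⟩ := d; rfl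

variable {G} in
/-- A dart is not its own reverse (no loops). [folklore] -/
theorem Dart.rev_ne (d : Dart G) : d.rev ≠ d := by
  obtain ⟨⟨a, b⟩, h⟩ := d
  intro heq
  have : b = a := congrArg (fun x : Dart G => x.1.1) heq
  exact G.irrefl (this ▸ h)

/-- The generating relation of the 2-subdivision `G₂` of `G`: the vertex `u` is joined to the
subdivision vertex `w_{u,v}` (the dart `(u,v)`), and `w_{u,v}` to `w_{v,u}`.
[cite: ChenFlumLiu2025, §12 (the graph G₂, Figure 12.1)] -/
def subdivRel : Fin v ⊕ Dart G → Fin v ⊕ Dart G → Prop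
  | .inl u, .inr d => u = d.1.1
  | .inr d, .inr d' => d' = d.rev
  | _, _ => False

/-- **The 2-subdivision `G₂`** of `G`: every edge `uv` is replaced by the path
`u, w_{u,v}, w_{v,u}, v`; the new vertices `w_{u,v}` are the darts of `G`.
[cite: ChenFlumLiu2025, §12 (the graph G₂)] -/
def subdiv : SimpleGraph (Fin v ⊕ Dart G) := SimpleGraph.fromRel (subdivRel G)

/-- Original vertices are not adjacent in `G₂`. [cite: ChenFlumLiu2025, §12 (G₂)] -/
theorem subdiv_not_adj_inl_inl (u w : Fin v) : ¬ (subdiv G).Adj (.inl u) (.inl w) := by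
  rintro ⟨-, h | h⟩ <;> exact h

/-- `u ~ w_{u',v}` in `G₂` iff `u = u'`. [cite: ChenFlumLiu2025, §12 (G₂)] -/
theorem subdiv_adj_inl_inr (u : Fin v) (d : Dart G) : (subdiv G).Adj (.inl u) (.inr d) ↔ u = d.1.1 := by
  simp only [subdiv, SimpleGraph.fromRel_adj, ne_eq, reduceCtorEq, not_false_eq_true, true_and, subdivRel,
    or_false]

/-- `w_{u',v} ~ u` in `G₂` iff `u = u'`. [cite: ChenFlumLiu2025, §12 (G₂)] -/
theorem subdiv_adj_inr_inl (u : Fin v) (d : Dart G) : (subdiv G).Adj (.inr d) (.inl u) ↔ u = d.1.1 := by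
  rw [SimpleGraph.adj_comm, subdiv_adj_inl_inr]

/-- `w_{u,v} ~ w_{u',v'}` in `G₂` iff `(u',v') = (v,u)`. [cite: ChenFlumLiu2025, §12 (G₂)] -/
theorem subdiv_adj_inr_inr (d d' : Dart G) : (subdiv G).Adj (.inr d) (.inr d') ↔ d' = d.rev := by
  simp only [subdiv, SimpleGraph.fromRel_adj, ne_eq, Sum.inr.injEq, subdivRel]
  constructor
  · rintro ⟨-, h | h⟩
    · exact h
    · rw [h, Dart.rev_rev]
  · intro h
    exact ⟨fun hdd' => d.rev_ne (h ▸ hdd'.symm), Or.inl h⟩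

section CFI

variable [DecidableRel G.Adj]

/-! ### The projection `p : Y(G) → G₂` -/

/-- The projection `p : V(Y^i(G)) → V(G₂)` of (12.4): middle vertices of the gadget of `u` go to
`u`, the link vertices `a(u,v)`, `b(u,v)` go to `w_{u,v}`. [cite: ChenFlumLiu2025, (12.4)] -/
def proj : CFIVertex G → Fin v ⊕ Dart G
  | .inl x => .inl x.1
  | .inr y => .inr y.1

/-- The subset carried by a middle vertex (`∅` on link vertices). [folklore] -/
def mids : CFIVertex G → Finset (Fin v)
  | .inl x => x.2.1
  | .inr _ => ∅

variable {G}

/-- A vertex over `u` is a middle vertex `m_{u,S}`. [cite: ChenFlumLiu2025, (12.4)] -/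
theorem exists_eq_inl_of_proj {x : CFIVertex G} {u : Fin v} (h : proj G x = .inl u) :
    ∃ S, x = .inl ⟨u, S⟩ := by
  rcases x with ⟨u', S⟩ | ⟨d, c⟩
  · simp only [proj, Sum.inl.injEq] at h
    subst h
    exact ⟨S, rfl⟩
  · simp [proj] at h

/-- A vertex over `w_{u,v}` is a link vertex `(u, v, c)`. [cite: ChenFlumLiu2025, (12.4)] -/
theorem exists_eq_inr_of_proj {x : CFIVertex G} {d : Dart G} (h : proj G x = .inr d) : ∃ c, x = .inr (d, c) := by
  rcases x with ⟨u', S⟩ | ⟨d', c⟩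
  · simp [proj] at h
  · simp only [proj, Sum.inr.injEq] at h
    subst h
    exact ⟨c, rfl⟩

variable (G)

/-- Adjacency of two link vertices of `CFI(G, T)`: they are the two ends `(u,v,c)`, `(v,u,c')` of
an edge, straight (`c = c'`) iff the edge is not twisted. [cite: CaiFurerImmerman1992, §6] -/
theorem cfiGraph_adj_inr_inr (T : Set (Sym2 (Fin v))) [DecidablePred (· ∈ T)] (p p' : Dart G) (c c' : Bool) :
    (cfiGraph G T).Adj (.inr (p, c)) (.inr (p', c')) ↔ p' = p.rev ∧ (c = c' ↔ s(p.1.1, p.1.2) ∉ T) := by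
  obtain ⟨⟨u, w⟩, h⟩ := p
  obtain ⟨⟨w', u'⟩, h'⟩ := p'
  simp only [cfiGraph, SimpleGraph.fromRel_adj, ne_eq, Prod.mk.injEq, cfiRel, Dart.rev,
    Subtype.mk.injEq]
  constructor
  · rintro ⟨-, ⟨rfl, rfl, hc⟩ | ⟨rfl, rfl, hc⟩⟩
    · exact ⟨⟨rfl, rfl⟩, hc⟩
    · refine ⟨⟨rfl, rfl⟩, ?_⟩
      rw [Sym2.eq_swap]
      exact ⟨fun hcc => hc.1 hcc.symm, fun hT => (hc.2 hT).symm⟩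
  · rintro ⟨⟨rfl, rfl⟩, hc⟩
    refine ⟨?_, Or.inl ⟨rfl, rfl, hc⟩⟩
    intro heq
    have h1 : w' = u' := by
      have := congrArg (fun x : CFIVertex G => match x with | .inr y => y.1.1.1 | .inl _ => u') heq
      exact this.symm
    subst h1
    exact G.irrefl h

variable {G}

/-- Adjacency of a link vertex and a middle vertex (the symmetric form of `cfiGraph_adj_inl_inr`).
[cite: CaiFurerImmerman1992, §6] -/
theorem cfiGraph_adj_inr_inl (T : Set (Sym2 (Fin v))) [DecidablePred (· ∈ T)] (u : Fin v)
    (S : {S : Finset (Fin v) // S ⊆ G.neighborFinset u ∧ Even S.card}) (p : Dart G) (c : Bool) :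
    (cfiGraph G T).Adj (.inr (p, c)) (.inl ⟨u, S⟩) ↔ u = p.1.1 ∧ (c = true ↔ p.1.2 ∈ S.1) := by
  rw [SimpleGraph.adj_comm, cfiGraph_adj_inl_inr]

/-! ### The zero section (Example 12.4) -/

/-- The map of Example 12.4 over the identity of `G₂`: `u ↦ ∅_u`, `w_{u,v} ↦ b(u,v)`.
[cite: ChenFlumLiu2025, Example 12.4] -/
def zeroLift : Fin v ⊕ Dart G → CFIVertex G
  | .inl u => .inl ⟨u, ⟨∅, Finset.empty_subset _, by simp⟩⟩
  | .inr d => .inr (d, false)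

/-- The zero section lies over the identity. [cite: ChenFlumLiu2025, Example 12.4] -/
@[simp] theorem proj_zeroLift (x : Fin v ⊕ Dart G) : proj G (zeroLift (G := G) x) = x := by
  cases x <;> rfl

/-- The zero section is a homomorphism `G₂ → Y(G)` (Example 12.4: `Hom⁰_id ≠ ∅`).
[cite: ChenFlumLiu2025, Example 12.4] -/
theorem isHom_zeroLift : Dvorak2010.IsHom (subdiv G) (cfiEven G) (zeroLift (G := G)) := by
  rintro (u | d) (u' | d') h
  · exact absurd h (subdiv_not_adj_inl_inl G u u')
  · rw [subdiv_adj_inl_inr] at h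
    subst h
    show (cfiGraph G ∅).Adj _ _
    rw [zeroLift, zeroLift, cfiGraph_adj_inl_inr]
    simp
  · rw [subdiv_adj_inr_inl] at h
    subst h
    show (cfiGraph G ∅).Adj _ _
    rw [zeroLift, zeroLift, cfiGraph_adj_inr_inl]
    simp
  · rw [subdiv_adj_inr_inr] at h
    subst h
    show (cfiGraph G ∅).Adj _ _
    rw [zeroLift, zeroLift, cfiGraph_adj_inr_inr]
    simp

/-! ### Differences of two lifts over the same map (the homogeneous system `Eq⁰_g`) -/

/-- The subset of the difference `m_{u,S} - m_{u',S'}` (`u' = u`): `S ∆ S'` is again an even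
subset of `N(u)` (`#(S ∆ S') + 2 #(S ∩ S') = #S + #S'`). [folklore] -/
theorem symmDiff_mem_gadget {u u' : Fin v} (S : {S : Finset (Fin v) // S ⊆ G.neighborFinset u ∧ Even S.card})
    (S' : {S : Finset (Fin v) // S ⊆ G.neighborFinset u' ∧ Even S.card}) (h : u' = u) :
    S.1 ∆ S'.1 ⊆ G.neighborFinset u ∧ Even (S.1 ∆ S'.1).card := by
  subst h
  refine ⟨symmDiff_subset_union.trans (Finset.union_subset S.2.1 S'.2.1), ?_⟩
  have hc : (S.1 ∆ S'.1).card + 2 * (S.1 ∩ S'.1).card = S.1.card + S'.1.card := by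
    have h1 : S.1 ∆ S'.1 = (S.1 \ S'.1) ∪ (S'.1 \ S.1) := symmDiff_def S.1 S'.1
    rw [h1, card_union_of_disjoint disjoint_sdiff_sdiff]
    have h2 := card_sdiff_add_card_inter S.1 S'.1
    have h3 := card_sdiff_add_card_inter S'.1 S.1
    rw [inter_comm S'.1 S.1] at h3
    omega
  obtain ⟨a, ha⟩ := S.2.2
  obtain ⟨b, hb⟩ := S'.2.2
  exact ⟨a + b - (S.1 ∩ S'.1).card, by omega⟩

/-- **The difference of two vertices of a CFI graph over the same vertex of `G₂`**: middle
vertices `m_{u,S}`, `m_{u,S'}` give `m_{u,S ∆ S'}`, link vertices `(d, c)`, `(d, c')` give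
`(d, c ⊕ c')` (junk: the first argument, when the two vertices lie over different vertices of
`G₂`). This is the passage from a solution of `Eq^i_g` and a fixed solution to a solution of the
homogeneous system `Eq⁰_g` in the proof of Thm. 12.2. [cite: ChenFlumLiu2025, Lemma 12.5 and proof of Thm 12.2] -/
def dsub : CFIVertex G → CFIVertex G → CFIVertex G
  | .inl ⟨u, S⟩, .inl ⟨u', S'⟩ =>
      if h : u' = u then .inl ⟨u, ⟨S.1 ∆ S'.1, symmDiff_mem_gadget S S' h⟩⟩
      else .inl ⟨u, S⟩
  | .inr (d, c), .inr (_, c') => .inr (d, xor c c')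
  | .inl x, .inr _ => .inl x
  | .inr y, .inl _ => .inr y

/-- The difference of two middle vertices of the same gadget. [cite: ChenFlumLiu2025, proof of Thm 12.2] -/
theorem dsub_inl_inl (u : Fin v) (S S' : {S : Finset (Fin v) // S ⊆ G.neighborFinset u ∧ Even S.card}) :
    ∃ h, dsub (G := G) (.inl ⟨u, S⟩) (.inl ⟨u, S'⟩) = .inl ⟨u, ⟨S.1 ∆ S'.1, h⟩⟩ := by
  exact ⟨symmDiff_mem_gadget S S' rfl, by simp [dsub]⟩

/-- The difference of two link vertices. [cite: ChenFlumLiu2025, proof of Thm 12.2] -/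
@[simp] theorem dsub_inr_inr (d d' : Dart G) (c c' : Bool) :
    dsub (G := G) (.inr (d, c)) (.inr (d', c')) = .inr (d, xor c c') := rfl

/-- The difference lies over the same vertex as its first argument. [cite: ChenFlumLiu2025, proof of Thm 12.2] -/
@[simp] theorem proj_dsub (x y : CFIVertex G) : proj G (dsub x y) = proj G x := by
  rcases x with ⟨u, S⟩ | ⟨d, c⟩ <;> rcases y with ⟨u', S'⟩ | ⟨d', c'⟩ <;> simp only [dsub, proj]
  split_ifs <;> rfl

/-- The subset of the difference of two middle vertices. [cite: ChenFlumLiu2025, proof of Thm 12.2] -/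
@[simp] theorem mids_dsub_inl_inl (u : Fin v) (S S' : {S : Finset (Fin v) // S ⊆ G.neighborFinset u ∧ Even S.card}) :
    mids G (dsub (G := G) (.inl ⟨u, S⟩) (.inl ⟨u, S'⟩)) = S.1 ∆ S'.1 := by
  obtain ⟨h, hh⟩ := dsub_inl_inl (G := G) u S S'
  rw [hh]; rfl

/-- Truth table of the gadget equation: if `c ↔ P` and `c₁ ↔ Q` then `c ⊕ c₁ ↔ P xor Q`. [folklore] -/
theorem xor_iff_of_iff {c c₁ : Bool} {P Q : Prop} (hc : c = true ↔ P) (hc₁ : c₁ = true ↔ Q) :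
    (xor c c₁ = true ↔ (P ∧ ¬ Q ∨ Q ∧ ¬ P)) := by
  cases c <;> cases c₁ <;> simp_all

/-- Truth table of the link equation: if `(c = c') ↔ R` and `(c₁ = c₁') ↔ R` then
`c ⊕ c₁ = c' ⊕ c₁'`. [folklore] -/
theorem xor_eq_xor_of_iff {c c' c₁ c₁' : Bool} {R : Prop} (h : c = c' ↔ R) (h₁ : c₁ = c₁' ↔ R) :
    xor c c₁ = xor c' c₁' := by
  cases c <;> cases c' <;> cases c₁ <;> cases c₁' <;> simp_all

/-- **Adjacent pairs have adjacent differences**: if `x ~ y` and `x₁ ~ y₁` in `Y^T(G)` with `x, x₁`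
over the same vertex of `G₂` and `y, y₁` over the same vertex, then `x - x₁ ~ y - y₁` in the
untwisted `Y(G)`. [cite: ChenFlumLiu2025, Lemma 12.5 and proof of Thm 12.2] -/
theorem adj_dsub {T : Set (Sym2 (Fin v))} [DecidablePred (· ∈ T)] {x x₁ y y₁ : CFIVertex G}
    (hxy : (cfiGraph G T).Adj x y) (hxy₁ : (cfiGraph G T).Adj x₁ y₁) (hx : proj G x₁ = proj G x)
    (hy : proj G y₁ = proj G y) : (cfiEven G).Adj (dsub x x₁) (dsub y y₁) := by
  show (cfiGraph G ∅).Adj (dsub x x₁) (dsub y y₁)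
  rcases x with ⟨u, S⟩ | ⟨d, c⟩ <;> rcases y with ⟨u', S'⟩ | ⟨d', c'⟩
  · exact absurd hxy (cfiGraph_not_adj_inl_inl G T _ _)
  · -- middle vertex to link vertex
    obtain ⟨S₁, rfl⟩ := exists_eq_inl_of_proj hx
    obtain ⟨c₁, rfl⟩ := exists_eq_inr_of_proj hy
    rw [cfiGraph_adj_inl_inr] at hxy hxy₁
    obtain ⟨rfl, h1⟩ := hxy
    obtain ⟨-, h2⟩ := hxy₁
    obtain ⟨h, hh⟩ := dsub_inl_inl (G := G) d'.1.1 S S₁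
    rw [hh, dsub_inr_inr, cfiGraph_adj_inl_inr]
    refine ⟨rfl, ?_⟩
    rw [Finset.mem_symmDiff]
    exact xor_iff_of_iff h1 h2
  · -- link vertex to middle vertex
    obtain ⟨c₁, rfl⟩ := exists_eq_inr_of_proj hx
    obtain ⟨S₁, rfl⟩ := exists_eq_inl_of_proj hy
    rw [cfiGraph_adj_inr_inl] at hxy hxy₁
    obtain ⟨rfl, h1⟩ := hxy
    obtain ⟨-, h2⟩ := hxy₁
    obtain ⟨h, hh⟩ := dsub_inl_inl (G := G) d.1.1 S' S₁
    rw [hh, dsub_inr_inr, cfiGraph_adj_inr_inl]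
    refine ⟨rfl, ?_⟩
    rw [Finset.mem_symmDiff]
    exact xor_iff_of_iff h1 h2
  · -- link vertex to link vertex
    obtain ⟨c₁, rfl⟩ := exists_eq_inr_of_proj hx
    obtain ⟨c₁', rfl⟩ := exists_eq_inr_of_proj hy
    rw [cfiGraph_adj_inr_inr] at hxy hxy₁
    obtain ⟨rfl, h1⟩ := hxy
    obtain ⟨-, h2⟩ := hxy₁
    rw [dsub_inr_inr, dsub_inr_inr, cfiGraph_adj_inr_inr]
    refine ⟨rfl, ?_⟩
    simp only [Set.mem_empty_iff_false, not_false_eq_true, iff_true]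
    exact xor_eq_xor_of_iff h1 h2

/-- **Differences of two lifts over the same map are lifts to the untwisted graph**: if
`f, f₁ : G₂ → Y^T(G)` are homomorphisms with `p ∘ f = p ∘ f₁`, then `α ↦ f α - f₁ α` is a
homomorphism `G₂ → Y(G)`. [cite: ChenFlumLiu2025, Lemma 12.5 and proof of Thm 12.2] -/
theorem isHom_dsub {T : Set (Sym2 (Fin v))} [DecidablePred (· ∈ T)]
    {f f₁ : Fin v ⊕ Dart G → CFIVertex G} (hf : Dvorak2010.IsHom (subdiv G) (cfiGraph G T) f)
    (hf₁ : Dvorak2010.IsHom (subdiv G) (cfiGraph G T) f₁) (hp : ∀ x, proj G (f₁ x) = proj G (f x)) :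
    Dvorak2010.IsHom (subdiv G) (cfiEven G) (fun x => dsub (f x) (f₁ x)) :=
  fun a b hab => adj_dsub (hf hab) (hf₁ hab) (hp a) (hp b)

/-- **Injectivity of the difference in its first argument** over a common vertex of `G₂`
("for `f₁ ≠ f₂` in `Hom^i_g` we have `x̄(f₁) ≠ x̄(f₂)`"). [cite: ChenFlumLiu2025, Lemma 12.5] -/
theorem dsub_left_injective {x x' y : CFIVertex G} (hx : proj G x = proj G y) (hx' : proj G x' = proj G y)
    (h : dsub x y = dsub x' y) : x = x' := by
  rcases y with ⟨u, S₁⟩ | ⟨d, c₁⟩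
  · obtain ⟨S, rfl⟩ := exists_eq_inl_of_proj hx
    obtain ⟨S', rfl⟩ := exists_eq_inl_of_proj hx'
    have key := congrArg (mids G) h
    rw [mids_dsub_inl_inl, mids_dsub_inl_inl] at key
    have key' : S.1 = S'.1 := symmDiff_left_inj.1 key
    rw [Subtype.ext key']
  · obtain ⟨c, rfl⟩ := exists_eq_inr_of_proj hx
    obtain ⟨c', rfl⟩ := exists_eq_inr_of_proj hx'
    rw [dsub_inr_inr, dsub_inr_inr] at h
    have h' : xor c c₁ = xor c' c₁ := by
      have := congrArg (fun z : CFIVertex G => match z with | .inr y => y.2 | .inl _ => true) h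
      exact this
    rw [Bool.xor_left_inj.1 h']

/-! ### No lift over the identity into the twisted graph (proof of Thm. 12.2) -/

omit [DecidableRel G.Adj] in
/-- Splitting a sum over ordered pairs with vanishing diagonal into the pairs `u < w`, each taken
with its reverse. [folklore] -/
theorem sum_pairs_eq_sum_lt (t : Fin v × Fin v → ℕ) (hdiag : ∀ u, t (u, u) = 0) :
    ∑ p, t p = ∑ p ∈ univ.filter (fun p : Fin v × Fin v => p.1 < p.2), (t p + t p.swap) := by
  rw [Finset.sum_add_distrib]
  rw [← Finset.sum_filter_add_sum_filter_not univ (fun p : Fin v × Fin v => p.1 < p.2) t]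
  congr 1
  have h1 : ∑ p ∈ univ.filter (fun p : Fin v × Fin v => ¬ p.1 < p.2), t p =
      ∑ p ∈ univ.filter (fun p : Fin v × Fin v => p.2 < p.1), t p := by
    symm
    apply Finset.sum_subset
    · intro p hp
      simp only [Finset.mem_filter, Finset.mem_univ, true_and] at hp ⊢
      exact lt_asymm hp
    · intro p hp hp'
      simp only [Finset.mem_filter, Finset.mem_univ, true_and, not_lt] at hp hp'
      have : p.1 = p.2 := le_antisymm hp' hp
      obtain ⟨a, b⟩ := p
      simp only at this
      subst this
      exact hdiag a
  rw [h1]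
  apply Finset.sum_equiv (Equiv.prodComm (Fin v) (Fin v))
  · intro p
    simp
  · intro p _
    rfl

omit [DecidableRel G.Adj] in
/-- An edge of `G` is `s(a, b)` with `a < b` adjacent. [folklore] -/
theorem exists_lt_of_mem_edgeSet {e : Sym2 (Fin v)} (he : e ∈ G.edgeSet) :
    ∃ a b : Fin v, a < b ∧ G.Adj a b ∧ e = s(a, b) := by
  induction e using Sym2.ind with
  | _ x y =>
    have hxy : G.Adj x y := (SimpleGraph.mem_edgeSet G).1 he
    rcases lt_or_gt_of_ne hxy.ne with h | h
    · exact ⟨x, y, h, hxy, rfl⟩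
    · exact ⟨y, x, h, hxy.symm, Sym2.eq_swap⟩

/-- **`Hom¹_id = ∅`** (proof of Thm. 12.2): there is no homomorphism `h : G₂ → Ỹ(G) = Y^{e}(G)`
with `p ∘ h = id`. Printed proof: the values of `h` solve the system `Eq¹_id`; adding all its
equations over `𝔽₂` every variable occurs twice while the right-hand sides add up to `1` (the one
twisted edge). Here: `h(u) = m_{u,S_u}` and `h(w_{u,v}) = (u, v, c_{uv})` with
`c_{uv} ↔ v ∈ S_u` and `c_{uv} = c_{vu}` exactly for the untwisted edges, so
`Σ_u |S_u| = #{(u,v) : c_{uv}}` is even (all `S_u` are even) and odd (pair each dart with its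
reverse). [cite: ChenFlumLiu2025, Thm 12.2 (proof)] -/
theorem not_isHom_of_proj_eq {e : Sym2 (Fin v)} [DecidablePred (· ∈ ({e} : Set (Sym2 (Fin v))))]
    (he : e ∈ G.edgeSet) {f : Fin v ⊕ Dart G → CFIVertex G}
    (hf : Dvorak2010.IsHom (subdiv G) (cfiGraph G ({e} : Set (Sym2 (Fin v)))) f)
    (hp : ∀ x, proj G (f x) = x) : False := by
  classical
  -- the data of `f`: subsets `S u` and bits `c d`
  have hshape₁ : ∀ u, ∃ S : {S : Finset (Fin v) // S ⊆ G.neighborFinset u ∧ Even S.card},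
      f (.inl u) = .inl ⟨u, S⟩ := fun u => exists_eq_inl_of_proj (hp (.inl u))
  choose S hS using hshape₁
  have hshape₂ : ∀ d : Dart G, ∃ c : Bool, f (.inr d) = .inr (d, c) := fun d => exists_eq_inr_of_proj (hp (.inr d))
  choose c hc using hshape₂
  -- (F1) the gadget equations
  have F1 : ∀ d : Dart G, (c d = true ↔ d.1.2 ∈ (S d.1.1).1) := by
    intro d
    have h := hf ((subdiv_adj_inl_inr G d.1.1 d).2 rfl)
    rw [hS, hc, cfiGraph_adj_inl_inr] at h
    exact h.2
  -- (F2) the link equations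
  have F2 : ∀ d : Dart G, (c d = c d.rev ↔ s(d.1.1, d.1.2) ≠ e) := by
    intro d
    have h := hf ((subdiv_adj_inr_inr G d d.rev).2 rfl)
    rw [hc, hc, cfiGraph_adj_inr_inr] at h
    simpa using h.2
  -- the bits as a function of two vertices
  let c' : Fin v → Fin v → Bool := fun u w => if h : G.Adj u w then c ⟨(u, w), h⟩ else false
  have hc'₁ : ∀ u w (h : G.Adj u w), c' u w = c ⟨(u, w), h⟩ := fun u w h => dif_pos h
  have hc'₂ : ∀ u w, ¬ G.Adj u w → c' u w = false := fun u w h => dif_neg h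
  -- the double count: N = Σ_u |S u| = Σ_{(u,w)} [c' u w]
  let t : Fin v × Fin v → ℕ := fun p => if c' p.1 p.2 = true then 1 else 0
  have hN : ∑ u, (S u).1.card = ∑ p, t p := by
    rw [Fintype.sum_prod_type]
    refine Finset.sum_congr rfl fun u _ => ?_
    simp only [t]
    rw [Finset.sum_boole, Nat.cast_id]
    congr 1
    ext w
    simp only [Finset.mem_filter, Finset.mem_univ, true_and]
    constructor
    · intro hw
      have huw : G.Adj u w := by simpa using (S u).2.1 hw
      rw [hc'₁ u w huw]
      exact (F1 ⟨(u, w), huw⟩).2 hw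
    · intro hw
      by_cases huw : G.Adj u w
      · rw [hc'₁ u w huw] at hw
        exact (F1 ⟨(u, w), huw⟩).1 hw
      · rw [hc'₂ u w huw] at hw
        exact absurd hw Bool.false_ne_true
  have heven : Even (∑ u, (S u).1.card) := Finset.even_sum _ fun u _ => (S u).2.2
  -- the right-hand side is odd: split into pairs `u < w`
  have hdiag : ∀ u, t (u, u) = 0 := fun u => by
    simp only [t, hc'₂ u u (G.irrefl), Bool.false_eq_true, if_false]
  rw [hN, sum_pairs_eq_sum_lt t hdiag] at heven
  -- the twisted edge as an ordered pair `a < b`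
  obtain ⟨a, b, hab, hadj, heab⟩ := exists_lt_of_mem_edgeSet he
  set L := univ.filter (fun p : Fin v × Fin v => p.1 < p.2) with hL
  have hmem : (a, b) ∈ L := by simp [hL, hab]
  rw [← Finset.add_sum_erase L _ hmem] at heven
  -- the term of the twisted edge is `1`
  have hone : t (a, b) + t (a, b).swap = 1 := by
    have h2 := F2 ⟨(a, b), hadj⟩
    simp only [ne_eq, heab, not_true_eq_false, iff_false] at h2
    simp only [t, Prod.swap_prod_mk, hc'₁ a b hadj, hc'₁ b a hadj.symm]
    change (if c ⟨(a, b), hadj⟩ = true then 1 else 0) + (if c (Dart.rev ⟨(a, b), hadj⟩) = true then 1 else 0) = 1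
    revert h2
    cases c ⟨(a, b), hadj⟩ <;> cases c (Dart.rev ⟨(a, b), hadj⟩) <;> simp
  -- every other term is even
  have hrest : Even (∑ p ∈ L.erase (a, b), (t p + t p.swap)) := by
    refine Finset.even_sum _ fun p hp => ?_
    rw [Finset.mem_erase] at hp
    obtain ⟨hpne, hpL⟩ := hp
    simp only [hL, Finset.mem_filter, Finset.mem_univ, true_and] at hpL
    obtain ⟨x, y⟩ := p
    simp only at hpL ⊢
    by_cases hxy : G.Adj x y
    · have hne : s(x, y) ≠ e := by
        rw [heab]
        intro h
        rcases Sym2.eq_iff.1 h with ⟨rfl, rfl⟩ | ⟨rfl, rfl⟩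
        · exact hpne rfl
        · exact lt_asymm hab hpL
      have h2 := (F2 ⟨(x, y), hxy⟩).2 hne
      simp only [t, Prod.swap_prod_mk, hc'₁ x y hxy, hc'₁ y x hxy.symm]
      change Even ((if c ⟨(x, y), hxy⟩ = true then 1 else 0) + (if c (Dart.rev ⟨(x, y), hxy⟩) = true then 1 else 0))
      rw [← h2]
      cases c ⟨(x, y), hxy⟩ <;> simp
    · simp only [t, Prod.swap_prod_mk, hc'₂ x y hxy, hc'₂ y x (fun h => hxy h.symm), Bool.false_eq_true,
        if_false, add_zero, Even.zero]
  rw [hone, add_comm, Nat.even_add_one] at heven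
  exact heven hrest

/-! ### `hom(G₂, Ỹ(G)) < hom(G₂, Y(G))` (Theorem 12.2) -/

/-- **Theorem 12.2 (in the form needed): `hom(G₂, Ỹ(G)) < hom(G₂, Y(G))`** for `Ỹ(G) = Y^e(G)`,
`e` an edge of `G`. Printed proof: `Hom(G₂, Y^i(G))` is the disjoint union over `g ∈ Hom(G₂, G₂)`
of the fibres `Hom^i_g = {f | p ∘ f = g}`; `|Hom^1_g| ∈ {0, |Hom^0_g|}` (an affine system and its
homogeneous part) and `Hom^1_id = ∅ ≠ Hom^0_id`. Here, equivalently: subtracting a fixed element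
of its fibre from every `f ∈ Hom(G₂, Ỹ(G))` is an injection into `Hom(G₂, Y(G))` (fibre by fibre,
`isHom_dsub`, `dsub_left_injective`) that misses the zero section over the identity
(`isHom_zeroLift`, `not_isHom_of_proj_eq`). [cite: ChenFlumLiu2025, Thm 12.2] -/
theorem card_hom_subdiv_lt {e : Sym2 (Fin v)} [DecidablePred (· ∈ ({e} : Set (Sym2 (Fin v))))]
    (he : e ∈ G.edgeSet) :
    Nat.card (subdiv G →g cfiGraph G ({e} : Set (Sym2 (Fin v)))) < Nat.card (subdiv G →g cfiEven G) := by
  classical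
  rw [Dvorak2010.card_hom_eq_card_subtype, Dvorak2010.card_hom_eq_card_subtype]
  set H₁ := {g : Fin v ⊕ Dart G → CFIVertex G // Dvorak2010.IsHom (subdiv G) (cfiGraph G ({e} : Set _)) g}
  set H₀ := {g : Fin v ⊕ Dart G → CFIVertex G // Dvorak2010.IsHom (subdiv G) (cfiEven G) g}
  haveI : Fintype H₁ := Fintype.ofFinite H₁
  haveI : Fintype H₀ := Fintype.ofFinite H₀
  rw [Nat.card_eq_fintype_card, Nat.card_eq_fintype_card]
  -- a chosen element in the fibre of every realised map `g`
  let base : (g : Fin v ⊕ Dart G → Fin v ⊕ Dart G) → (∃ f₁ : H₁, proj G ∘ f₁.1 = g) → H₁ :=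
    fun _ h => Classical.choose h
  have hbase : ∀ g (h : ∃ f₁ : H₁, proj G ∘ f₁.1 = g), proj G ∘ (base g h).1 = g :=
    fun g h => Classical.choose_spec h
  have hex : ∀ f : H₁, ∃ f₁ : H₁, proj G ∘ f₁.1 = proj G ∘ f.1 := fun f => ⟨f, rfl⟩
  let Φ : H₁ → H₀ := fun f =>
    ⟨fun x => dsub (f.1 x) ((base _ (hex f)).1 x),
      isHom_dsub f.2 (base _ (hex f)).2 fun x => congrFun (hbase _ (hex f)) x⟩
  refine Fintype.card_lt_of_injective_not_surjective Φ ?_ ?_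
  · intro f f' hff'
    have hval : ∀ x, dsub (f.1 x) ((base _ (hex f)).1 x) = dsub (f'.1 x) ((base _ (hex f')).1 x) :=
      fun x => congrFun (congrArg Subtype.val hff') x
    have hpf : proj G ∘ f.1 = proj G ∘ f'.1 := by
      funext x
      have := congrArg (proj G) (hval x)
      rwa [proj_dsub, proj_dsub] at this
    have hbb : base _ (hex f) = base _ (hex f') := by
      have key : ∀ (g g' : Fin v ⊕ Dart G → Fin v ⊕ Dart G) (h : ∃ f₁ : H₁, proj G ∘ f₁.1 = g)
          (h' : ∃ f₁ : H₁, proj G ∘ f₁.1 = g'), g = g' → base g h = base g' h' := by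
        intro g g' h h' hgg'
        subst hgg'
        rfl
      exact key _ _ _ _ hpf
    apply Subtype.ext
    funext x
    have h1 := hval x
    rw [hbb] at h1
    refine dsub_left_injective ?_ ?_ h1
    · have := congrFun (hbase _ (hex f')) x
      simp only [Function.comp_apply] at this
      rw [this]
      exact (congrFun hpf x)
    · have := congrFun (hbase _ (hex f')) x
      simp only [Function.comp_apply] at this
      rw [this]
  · intro hsurj
    obtain ⟨f, hf⟩ := hsurj ⟨zeroLift, isHom_zeroLift⟩
    have hval : ∀ x, dsub (f.1 x) ((base _ (hex f)).1 x) = zeroLift x :=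
      fun x => congrFun (congrArg Subtype.val hf) x
    refine not_isHom_of_proj_eq he f.2 fun x => ?_
    have := congrArg (proj G) (hval x)
    rwa [proj_dsub, proj_zeroLift] at this

end CFI

/-! ### Rooted tree decompositions given by parent pointers and ranks -/

/-- A **rooted tree decomposition presented by parent pointers**: a root, a parent map lowering a
rank function away from the root, bags with (T2), and (T1)+(T3) in the rooted form "every vertex
has a home node containing it, and a vertex of the bag of any other node lies in the bag of its
parent" (so the nodes containing a vertex are exactly a subtree hanging from its home). This is
the normal form of a rooted/nice tree decomposition (Cygan et al., *Parameterized Algorithms*,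
§7.2); it is converted to the tree's `TreeDecomposition` below. [folklore] -/
structure RankedTD {W : Type*} (F : SimpleGraph W) (ι : Type*) where
  /-- The root node. -/
  root : ι
  /-- The parent of a node (its value at the root is irrelevant). -/
  parent : ι → ι
  /-- A rank function, lowered by the parent map. -/
  rank : ι → ℕ
  /-- Parents have smaller rank. -/
  rank_parent_lt : ∀ i, i ≠ root → rank (parent i) < rank i
  /-- The bags. -/
  bag : ι → Finset W
  /-- The home node of a vertex. -/
  home : W → ι
  /-- (T1): the home bag contains the vertex. -/
  mem_bag_home : ∀ x, x ∈ bag (home x)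
  /-- (T2): both ends of an edge lie in a common bag. -/
  exists_mem_bag_of_adj : ∀ ⦃x y : W⦄, F.Adj x y → ∃ t, x ∈ bag t ∧ y ∈ bag t
  /-- (T3), rooted: away from its home, a vertex of a bag lies in the parent bag. -/
  mem_bag_parent : ∀ ⦃x : W⦄ ⦃i : ι⦄, x ∈ bag i → i ≠ home x → i ≠ root ∧ x ∈ bag (parent i)

namespace RankedTD

variable {W ι : Type*} {F : SimpleGraph W} (R : RankedTD F ι)

/-- The tree of parent pointers. [folklore] -/
def tree : SimpleGraph ι := SimpleGraph.fromRel fun i j => i ≠ R.root ∧ R.parent i = j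

/-- Adjacency in the tree of parent pointers. [folklore] -/
theorem tree_adj {i j : ι} :
    R.tree.Adj i j ↔ i ≠ j ∧ ((i ≠ R.root ∧ R.parent i = j) ∨ (j ≠ R.root ∧ R.parent j = i)) :=
  SimpleGraph.fromRel_adj _ _ _

/-- A non-root node differs from its parent. [folklore] -/
theorem parent_ne {i : ι} (hi : i ≠ R.root) : R.parent i ≠ i := fun h => by
  have := R.rank_parent_lt i hi
  rw [h] at this
  exact lt_irrefl _ this

/-- A non-root node is adjacent to its parent. [folklore] -/
theorem adj_parent {i : ι} (hi : i ≠ R.root) : R.tree.Adj i (R.parent i) :=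
  R.tree_adj.2 ⟨(R.parent_ne hi).symm, Or.inl ⟨hi, rfl⟩⟩

/-- Every node reaches the root along parents, and the root has the least rank. [folklore] -/
theorem reachable_root_and_rank_lt :
    ∀ (n : ℕ) (i : ι), R.rank i = n → R.tree.Reachable i R.root ∧ (i ≠ R.root → R.rank R.root < R.rank i) := by
  intro n
  induction n using Nat.strong_induction_on with
  | _ n ih =>
    intro i hi
    by_cases h : i = R.root
    · subst h
      exact ⟨SimpleGraph.Reachable.refl _, fun h => (h rfl).elim⟩
    · have hlt : R.rank (R.parent i) < n := hi ▸ R.rank_parent_lt i h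
      obtain ⟨hreach, hrk⟩ := ih _ hlt (R.parent i) rfl
      refine ⟨(R.adj_parent h).reachable.trans hreach, fun _ => ?_⟩
      by_cases hp : R.parent i = R.root
      · rw [← hp]; exact R.rank_parent_lt i h
      · exact (hrk hp).trans (R.rank_parent_lt i h)

/-- The tree of parent pointers is connected. [folklore] -/
theorem tree_connected : R.tree.Connected :=
  (SimpleGraph.connected_iff _).2
    ⟨fun a b => (R.reachable_root_and_rank_lt _ a rfl).1.trans (R.reachable_root_and_rank_lt _ b rfl).1.symm,
      ⟨R.root⟩⟩

/-- The edges of the tree of parent pointers are the pairs `{i, parent i}`, `i ≠ root`, without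
repetition. [folklore] -/
theorem card_edgeSet_tree [Finite ι] : Nat.card R.tree.edgeSet + 1 = Nat.card ι := by
  classical
  set f : {i : ι // i ≠ R.root} → R.tree.edgeSet := fun i =>
    ⟨s((i : ι), R.parent i), (SimpleGraph.mem_edgeSet _).2 (R.adj_parent i.2)⟩ with hf
  have hbij : Function.Bijective f := by
    constructor
    · rintro ⟨a, ha⟩ ⟨b, hb⟩ hab
      simp only [hf, Subtype.mk.injEq, Sym2.eq_iff] at hab
      rcases hab with ⟨h, -⟩ | ⟨h1, h2⟩
      · exact Subtype.ext h
      · exfalso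
        have hpa := R.rank_parent_lt a ha
        have hpb := R.rank_parent_lt b hb
        rw [h2] at hpa
        rw [← h1] at hpb
        exact lt_asymm hpa hpb
    · rintro ⟨e, he⟩
      induction e using Sym2.ind with
      | _ x y =>
        rw [SimpleGraph.mem_edgeSet, tree_adj] at he
        rcases he.2 with ⟨hx, hxy⟩ | ⟨hy, hyx⟩
        · exact ⟨⟨x, hx⟩, Subtype.ext (by simp [hf, hxy])⟩
        · exact ⟨⟨y, hy⟩, Subtype.ext (by simp [hf, hyx, Sym2.eq_swap])⟩
  rw [← Nat.card_eq_of_bijective f hbij, ← Finite.card_option]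
  exact Nat.card_congr (Equiv.optionSubtypeNe R.root)

/-- The tree of parent pointers is a tree. [folklore] -/
theorem isTree [Finite ι] : R.tree.IsTree := by
  rw [SimpleGraph.isTree_iff_connected_and_card]
  exact ⟨R.tree_connected, R.card_edgeSet_tree⟩

/-- (T3): the nodes whose bags contain a vertex induce a connected subtree — each is joined to the
home of the vertex along parents whose bags contain it. [folklore] -/
theorem connected_induce (x : W) : (R.tree.induce {t | x ∈ R.bag t}).Connected := by
  set S : Set ι := {t | x ∈ R.bag t} with hS
  have hhome : R.home x ∈ S := R.mem_bag_home x
  have hreach : ∀ (n : ℕ) (i : ι) (hi : x ∈ R.bag i), R.rank i = n →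
      (R.tree.induce S).Reachable ⟨i, hi⟩ ⟨R.home x, hhome⟩ := by
    intro n
    induction n using Nat.strong_induction_on with
    | _ n ih =>
      intro i hi hin
      by_cases him : i = R.home x
      · subst him
        rfl
      · obtain ⟨hroot, hp⟩ := R.mem_bag_parent hi him
        have hadj : (R.tree.induce S).Adj ⟨i, hi⟩ ⟨R.parent i, hp⟩ := by
          rw [SimpleGraph.induce_adj]
          exact R.adj_parent hroot
        exact hadj.reachable.trans (ih _ (hin ▸ R.rank_parent_lt i hroot) (R.parent i) hp rfl)
  refine (SimpleGraph.connected_iff _).2 ⟨fun a b => ?_, ⟨⟨R.home x, hhome⟩⟩⟩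
  exact (hreach _ a.1 a.2 rfl).trans (hreach _ b.1 b.2 rfl).symm

/-- **A rooted decomposition by parent pointers is a tree decomposition** (same bags).
[folklore] -/
def toTreeDecomposition [Finite ι] : Literature.Combinatorics.SimpleGraph.TreeDecomposition F ι where
  tree := R.tree
  isTree := R.isTree
  bag := R.bag
  exists_mem_bag_of_adj := R.exists_mem_bag_of_adj
  connected_induce := R.connected_induce

/-- The bags of `toTreeDecomposition` are the given ones. [folklore] -/
@[simp] theorem toTreeDecomposition_bag [Finite ι] (t : ι) : R.toTreeDecomposition.bag t = R.bag t := rfl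

end RankedTD

/-! ### Rooted tree decompositions of `G` in list form, decoded -/

section ListForm

open Literature.Combinatorics.SimpleGraph Literature.Combinatorics.SimpleGraph.ListTD

variable {G}

/-- An optimal tree decomposition of `G` in rooted list form (vertices named by their values):
parents, bags of length `≤ treewidth + 1` covering the edges. [cite: CyganEtAl2015, §7.2] -/
theorem exists_listTD {k' : ℕ} (hk : treewidth G ≤ k') :
    ∃ par bags, IsRootedTD v par bags ∧
      (∀ u w : Fin v, G.Adj u w → ∃ t, t < bags.length ∧ (u : ℕ) ∈ bagOf bags t ∧ (w : ℕ) ∈ bagOf bags t) ∧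
      ∀ t, t < bags.length → (bagOf bags t).length ≤ k' + 1 := by
  simpa using exists_isRootedTD_of_treewidth_le (Equiv.refl (Fin v)) hk

/-- The bag at index `t` of a list-form decomposition, decoded to a set of vertices of `G`.
[folklore] -/
def decode (bags : List (List ℕ)) (t : ℕ) : Finset (Fin v) :=
  univ.filter fun u : Fin v => (u : ℕ) ∈ bagOf bags t

omit G in
/-- Membership in a decoded bag. [folklore] -/
@[simp] theorem mem_decode {bags : List (List ℕ)} {t : ℕ} {u : Fin v} : u ∈ decode (v := v) bags t ↔ (u : ℕ) ∈ bagOf bags t := by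
  simp [decode]

omit G in
/-- A decoded bag is not larger than the listed bag. [folklore] -/
theorem card_decode_le (bags : List (List ℕ)) (t : ℕ) : (decode (v := v) bags t).card ≤ (bagOf bags t).length := by
  classical
  refine le_trans ?_ (List.toFinset_card_le (bagOf bags t))
  refine Finset.card_le_card_of_injOn (fun u : Fin v => (u : ℕ)) (fun u hu => ?_) (Fin.val_injective.injOn)
  rw [Finset.mem_coe, List.mem_toFinset]
  exact mem_decode.1 hu

end ListForm

/-! ### The tree decomposition of `G₂` for bags of size `≥ 3` (§12, p. 39) -/

section Wide

open Literature.Combinatorics.SimpleGraph Literature.Combinatorics.SimpleGraph.ListTD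

variable {G}
variable {par : List ℕ} {bags : List (List ℕ)} (hD : IsRootedTD v par bags)
  (hT2 : ∀ u w : Fin v, G.Adj u w → ∃ t, t < bags.length ∧ (u : ℕ) ∈ bagOf bags t ∧ (w : ℕ) ∈ bagOf bags t)

/-- The dart of an edge pointing upwards in the order of `Fin v` (`u < w`). [folklore] -/
def lo (d : Dart G) : Dart G := if d.1.1 < d.1.2 then d else d.rev

omit hD in
/-- The two ends of `lo d` are the two ends of `d`. [folklore] -/
theorem lo_ends (d : Dart G) : ((lo d).1.1 = d.1.1 ∧ (lo d).1.2 = d.1.2) ∨ ((lo d).1.1 = d.1.2 ∧ (lo d).1.2 = d.1.1) := by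
  unfold lo
  split_ifs
  · exact Or.inl ⟨rfl, rfl⟩
  · exact Or.inr ⟨rfl, rfl⟩

include hT2 in
/-- A node of the decomposition of `G` whose bag holds both ends of the edge under a dart (the
node `t` with `u, v ∈ B_t` chosen on p. 39). [cite: ChenFlumLiu2025, §12 (tree decomposition of G₂)] -/
theorem exists_edgeNode (d : Dart G) :
    ∃ t : ℕ, t < bags.length ∧ (d.1.1 : ℕ) ∈ bagOf bags t ∧ (d.1.2 : ℕ) ∈ bagOf bags t := by
  obtain ⟨t, ht, h1, h2⟩ := hT2 (lo d).1.1 (lo d).1.2 (lo d).2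
  rcases lo_ends d with ⟨e1, e2⟩ | ⟨e1, e2⟩
  · rw [e1] at h1; rw [e2] at h2; exact ⟨t, ht, h1, h2⟩
  · rw [e1] at h1; rw [e2] at h2; exact ⟨t, ht, h2, h1⟩

/-- **The tree decomposition of `G₂` of §12** (p. 39), in rooted form, from a rooted decomposition
of `G` in list form: the old bags, and for every edge `uv` (`u < v`) two new nodes — the dart
`(u,v)` carrying `B₁ = {u, w_{u,v}, v}`, child of a node whose bag holds `u` and `v`, and the
dart `(v,u)` carrying `B₂ = {w_{u,v}, w_{v,u}, v}`, child of the former. Bags have at most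
`max(width + 1, 3)` vertices. [cite: ChenFlumLiu2025, §12 (tree decomposition of G₂, bags B₁, B₂)] -/
noncomputable def wideTD : RankedTD (subdiv G) (Fin bags.length ⊕ Dart G) where
  root := .inl ⟨0, hD.pos⟩
  parent
    | .inl t => .inl (if h : (t : ℕ) = 0 then t else ⟨parOf par t, (hD.par_lt t (Nat.pos_of_ne_zero h) t.2).trans t.2⟩)
    | .inr d => if d.1.1 < d.1.2 then
        .inl ⟨Classical.choose (exists_edgeNode hT2 d), (Classical.choose_spec (exists_edgeNode hT2 d)).1⟩
      else .inr d.rev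
  rank
    | .inl t => t
    | .inr d => if d.1.1 < d.1.2 then bags.length else bags.length + 1
  rank_parent_lt := by
    rintro (t | d) ht
    · have h0 : (t : ℕ) ≠ 0 := fun h => ht (by rw [Sum.inl.injEq]; exact Fin.ext h)
      simp only [dif_neg h0]
      exact hD.par_lt t (Nat.pos_of_ne_zero h0) t.2
    · by_cases hlt : d.1.1 < d.1.2
      · simp only [hlt, if_true]
        exact (Classical.choose_spec (exists_edgeNode hT2 d)).1
      · have hrev : d.rev.1.1 < d.rev.1.2 := lt_of_le_of_ne (not_lt.1 hlt) (fun h => G.irrefl ((show d.1.2 = d.1.1 from h) ▸ d.2))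
        simp only [hlt, if_false, Dart.rev]
        simp [Dart.rev] at hrev
        simp [hrev]
  bag
    | .inl t => (decode bags t).map Function.Embedding.inl
    | .inr d => if d.1.1 < d.1.2 then {.inl d.1.1, .inr d, .inl d.1.2} else {.inr d.rev, .inr d, .inl d.1.1}
  home
    | .inl u => .inl ⟨firstBag bags u, (firstBag_spec (hD.cover u (Finset.mem_range.2 u.2))).1⟩
    | .inr d => .inr d
  mem_bag_home := by
    rintro (u | d)
    · simp only [Finset.mem_map, Function.Embedding.inl_apply, Sum.inl.injEq, exists_eq_right, mem_decode]
      exact (firstBag_spec (hD.cover u (Finset.mem_range.2 u.2))).2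
    · by_cases hlt : d.1.1 < d.1.2 <;> simp [hlt]
  exists_mem_bag_of_adj := by
    rintro (u | d) (u' | d') h
    · exact absurd h (subdiv_not_adj_inl_inl G u u')
    · rw [subdiv_adj_inl_inr] at h
      subst h
      refine ⟨.inr d', ?_, ?_⟩ <;> by_cases hlt : d'.1.1 < d'.1.2 <;> simp [hlt]
    · rw [subdiv_adj_inr_inl] at h
      subst h
      refine ⟨.inr d, ?_, ?_⟩ <;> by_cases hlt : d.1.1 < d.1.2 <;> simp [hlt]
    · rw [subdiv_adj_inr_inr] at h
      subst h
      by_cases hlt : d.1.1 < d.1.2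
      · have hrev : ¬ d.rev.1.1 < d.rev.1.2 := by simp [Dart.rev]; exact hlt.le
        refine ⟨.inr d.rev, ?_, ?_⟩ <;> simp [hrev]
      · refine ⟨.inr d, ?_, ?_⟩ <;> simp [hlt]
  mem_bag_parent := by
    rintro x (t | d) hx hne
    · -- an old node
      simp only [Finset.mem_map, Function.Embedding.inl_apply] at hx
      obtain ⟨u, hu, rfl⟩ := hx
      rw [mem_decode] at hu
      have hfb := firstBag_le t.2 hu
      have hne' : firstBag bags u ≠ t := fun h => hne (by rw [Sum.inl.injEq]; exact Fin.ext h.symm)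
      have hlt : firstBag bags u < t := lt_of_le_of_ne hfb hne'
      have ht0 : (t : ℕ) ≠ 0 := by omega
      refine ⟨fun h => ht0 (by rw [Sum.inl.injEq] at h; exact congrArg Fin.val h), ?_⟩
      simp only [dif_neg ht0, Finset.mem_map, Function.Embedding.inl_apply, Sum.inl.injEq, exists_eq_right,
        mem_decode]
      exact hD.rooted u (firstBag bags u) t hlt t.2 hu (firstBag_spec ⟨t, t.2, hu⟩).2
    · -- a dart node
      refine ⟨by simp, ?_⟩
      by_cases hlt : d.1.1 < d.1.2
      · simp only [hlt, if_true, Finset.mem_insert, Finset.mem_singleton] at hx ⊢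
        have hτ := Classical.choose_spec (exists_edgeNode hT2 d)
        rcases hx with rfl | rfl | rfl
        · simp only [Finset.mem_map, Function.Embedding.inl_apply, Sum.inl.injEq, exists_eq_right, mem_decode]
          exact hτ.2.1
        · exact absurd rfl hne
        · simp only [Finset.mem_map, Function.Embedding.inl_apply, Sum.inl.injEq, exists_eq_right, mem_decode]
          exact hτ.2.2
      · have hrev : d.rev.1.1 < d.rev.1.2 := lt_of_le_of_ne (not_lt.1 hlt) (fun h => G.irrefl ((show d.1.2 = d.1.1 from h) ▸ d.2))
        simp only [hlt, if_false, Finset.mem_insert, Finset.mem_singleton] at hx ⊢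
        rw [if_pos hrev]
        rcases hx with rfl | rfl | rfl
        · simp
        · exact absurd rfl hne
        · simp [Dart.rev]

/-- The bags of `wideTD` have at most `max (K, 3)` vertices when the listed bags have length `≤ K`.
[cite: ChenFlumLiu2025, §12 (tree decomposition of G₂)] -/
theorem card_bag_wideTD_le {K : ℕ} (hK : ∀ t, t < bags.length → (bagOf bags t).length ≤ K)
    (i : Fin bags.length ⊕ Dart G) : ((wideTD hD hT2).bag i).card ≤ max K 3 := by
  rcases i with t | d
  · show ((decode bags t).map Function.Embedding.inl).card ≤ _
    rw [Finset.card_map]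
    exact ((card_decode_le bags t).trans (hK t t.2)).trans (le_max_left _ _)
  · show (if d.1.1 < d.1.2 then ({.inl d.1.1, .inr d, .inl d.1.2} : Finset (Fin v ⊕ Dart G))
      else {.inr d.rev, .inr d, .inl d.1.1}).card ≤ _
    refine le_trans ?_ (le_max_right _ _)
    split_ifs <;> exact Finset.card_le_three

end Wide

/-! ### The case of width `1`: rooting `G` from a decomposition with bags of size `≤ 2` -/

section Narrow

open Literature.Combinatorics.SimpleGraph Literature.Combinatorics.SimpleGraph.ListTD

variable {G}
variable {par : List ℕ} {bags : List (List ℕ)} (hD : IsRootedTD v par bags)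
  (hT2 : ∀ u w : Fin v, G.Adj u w → ∃ t, t < bags.length ∧ (u : ℕ) ∈ bagOf bags t ∧ (w : ℕ) ∈ bagOf bags t)
  (h2 : ∀ t, t < bags.length → (bagOf bags t).length ≤ 2)

include hD hT2 in
/-- **Claim.** For an edge `uw` of `G` whose end `u` enters the decomposition not later than `w`
(first bags `firstBag u ≤ firstBag w`), `u` lies in the first bag of `w`: the first bags of `u`
and `w` are ancestors of a bag holding the edge, hence comparable, and `u` lies in every bag
between that bag and its first bag. [cite: CyganEtAl2015, §7.2 (Lemma 7.3)] -/
theorem mem_bagOf_firstBag_of_adj {u w : Fin v} (huw : G.Adj u w)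
    (h : firstBag bags u ≤ firstBag bags w) : (u : ℕ) ∈ bagOf bags (firstBag bags w) := by
  obtain ⟨t, ht, hu, hw⟩ := hT2 u w huw
  have hau := isAnc_firstBag hD ht hu
  have haw := isAnc_firstBag hD ht hw
  rcases isAnc_total hau haw with h1 | h1
  · exact mem_bagOf_of_isAnc hD ht hu haw h1
  · have hle := h1.le hD
    have heq : firstBag bags u = firstBag bags w := le_antisymm h hle
    rw [← heq]
    exact (firstBag_spec ⟨t, ht, hu⟩).2

omit G in
/-- In a list without repetition of length `≤ 2`, two members different from a third member
coincide. [folklore] -/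
theorem eq_of_mem_of_length_le_two {l : List ℕ} (hl : l.Nodup) (hlen : l.length ≤ 2) {a b c : ℕ}
    (ha : a ∈ l) (hb : b ∈ l) (hc : c ∈ l) (hac : a ≠ c) (hbc : b ≠ c) : a = b := by
  classical
  by_contra hab
  have hsub : ({a, b, c} : Finset ℕ) ⊆ l.toFinset := by
    intro x hx
    simp only [Finset.mem_insert, Finset.mem_singleton] at hx
    rw [List.mem_toFinset]
    rcases hx with rfl | rfl | rfl <;> assumption
  have hcard : ({a, b, c} : Finset ℕ).card = 3 := by
    rw [Finset.card_insert_of_notMem (by simp [hab, hac]), Finset.card_insert_of_notMem (by simp [hbc]),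
      Finset.card_singleton]
  have h1 := Finset.card_le_card hsub
  rw [hcard, List.toFinset_card_of_nodup hl] at h1
  omega

/-- The **vertex rank** read off the decomposition: first bag first, vertex number next.
[folklore] -/
noncomputable def vrk (bags : List (List ℕ)) (u : Fin v) : ℕ := firstBag bags u * v + u

omit G in
/-- A vertex of smaller rank enters the decomposition not later. [folklore] -/
theorem firstBag_le_of_vrk_lt {u w : Fin v} (h : vrk bags u < vrk bags w) : firstBag bags u ≤ firstBag bags w := by
  by_contra hlt
  rw [not_le] at hlt
  unfold vrk at h
  have h1 : firstBag bags w * v + w < (firstBag bags w + 1) * v := by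
    have := w.2; rw [Nat.add_mul, one_mul]; omega
  have h2 : (firstBag bags w + 1) * v ≤ firstBag bags u * v := Nat.mul_le_mul_right v hlt
  omega

omit G in
/-- The vertex rank is injective. [folklore] -/
theorem vrk_injective : Function.Injective (vrk (v := v) bags) := by
  intro u w h
  rcases lt_trichotomy (firstBag bags u) (firstBag bags w) with hlt | heq | hlt
  · exfalso
    have h1 : firstBag bags u * v + u < (firstBag bags u + 1) * v := by
      have := u.2; rw [Nat.add_mul, one_mul]; omega
    have h2 : (firstBag bags u + 1) * v ≤ firstBag bags w * v := Nat.mul_le_mul_right v hlt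
    unfold vrk at h; omega
  · unfold vrk at h
    rw [heq] at h
    exact Fin.ext (by omega)
  · exfalso
    have h1 : firstBag bags w * v + w < (firstBag bags w + 1) * v := by
      have := w.2; rw [Nat.add_mul, one_mul]; omega
    have h2 : (firstBag bags w + 1) * v ≤ firstBag bags u * v := Nat.mul_le_mul_right v hlt
    unfold vrk at h; omega

/-- `u` is a **lower neighbour** of `w`: adjacent and of smaller rank. [folklore] -/
def Below (bags : List (List ℕ)) (u w : Fin v) : Prop := G.Adj u w ∧ vrk bags u < vrk bags w

include hD hT2 h2 in
/-- **With bags of size `≤ 2`, every vertex has at most one lower neighbour** (both lie, with the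
vertex itself, in its first bag). [cite: ChenFlumLiu2025, §12 ("if tw(G) = 1, then G is a tree")] -/
theorem below_unique {u₁ u₂ w : Fin v} (h₁ : Below (G := G) bags u₁ w) (h₂ : Below (G := G) bags u₂ w) : u₁ = u₂ := by
  have hm₁ := mem_bagOf_firstBag_of_adj hD hT2 h₁.1 (firstBag_le_of_vrk_lt h₁.2)
  have hm₂ := mem_bagOf_firstBag_of_adj hD hT2 h₂.1 (firstBag_le_of_vrk_lt h₂.2)
  have hw := firstBag_spec (hD.cover w (Finset.mem_range.2 w.2))
  have key := eq_of_mem_of_length_le_two (hD.bag_nodup _) (h2 _ hw.1) hm₁ hm₂ hw.2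
    (fun h => h₁.1.ne (Fin.ext h)) (fun h => h₂.1.ne (Fin.ext h))
  exact Fin.ext key

open scoped Classical in
/-- **The parent of a vertex** in the rooting of `G` read off the decomposition: its lower
neighbour if it has one, itself otherwise. [folklore] -/
noncomputable def vpar (bags : List (List ℕ)) (w : Fin v) : Fin v :=
  if h : ∃ u, Below (G := G) bags u w then Classical.choose h else w

/-- A proper parent is a lower neighbour. [folklore] -/
theorem below_vpar {w : Fin v} (h : vpar (G := G) bags w ≠ w) : Below (G := G) bags (vpar (G := G) bags w) w := by
  classical
  unfold vpar at h ⊢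
  split_ifs with hex
  · exact Classical.choose_spec hex
  · rw [dif_neg hex] at h
    exact (h rfl).elim

include hD hT2 h2 in
/-- A lower neighbour is the parent. [folklore] -/
theorem vpar_eq_of_below {u w : Fin v} (h : Below (G := G) bags u w) : vpar (G := G) bags w = u := by
  classical
  have hex : ∃ u, Below (G := G) bags u w := ⟨u, h⟩
  have h1 : vpar (G := G) bags w = Classical.choose hex := by
    unfold vpar; rw [dif_pos hex]
  rw [h1]
  exact below_unique hD hT2 h2 (Classical.choose_spec hex) h

include hD hT2 h2 in
/-- **Every edge of `G` is a tree edge of the rooting**: one end is the proper parent of the other.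
[cite: ChenFlumLiu2025, §12 ("if tw(G) = 1, then G is a tree")] -/
theorem vpar_eq_or_of_adj {u w : Fin v} (huw : G.Adj u w) :
    (vpar (G := G) bags w = u ∧ vpar (G := G) bags w ≠ w) ∨ (vpar (G := G) bags u = w ∧ vpar (G := G) bags u ≠ u) := by
  rcases lt_or_gt_of_ne (vrk_injective.ne huw.ne) with hlt | hlt
  · left
    have := vpar_eq_of_below hD hT2 h2 ⟨huw, hlt⟩
    exact ⟨this, by rw [this]; exact huw.ne⟩
  · right
    have := vpar_eq_of_below hD hT2 h2 ⟨huw.symm, hlt⟩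
    exact ⟨this, by rw [this]; exact huw.ne.symm⟩

/-- The rank of a proper parent is smaller. [folklore] -/
theorem vrk_vpar_lt {w : Fin v} (h : vpar (G := G) bags w ≠ w) : vrk bags (vpar (G := G) bags w) < vrk bags w :=
  (below_vpar h).2

/-- A vertex with a proper parent is adjacent to it. [folklore] -/
theorem adj_vpar {w : Fin v} (h : vpar (G := G) bags w ≠ w) : G.Adj w (vpar (G := G) bags w) :=
  (below_vpar h).1.symm

/-- The dart from a vertex up to its proper parent. [folklore] -/
noncomputable def upDart (w : Fin v) (h : vpar (G := G) bags w ≠ w) : Dart G := ⟨(w, vpar (G := G) bags w), adj_vpar h⟩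

/-- A dart **points upwards** if it goes from a vertex to its proper parent. [folklore] -/
def IsUp (bags : List (List ℕ)) (d : Dart G) : Prop := vpar (G := G) bags d.1.1 = d.1.2 ∧ vpar (G := G) bags d.1.1 ≠ d.1.1

include hD hT2 h2 in
/-- One of the two darts of an edge points upwards. [folklore] -/
theorem isUp_or_isUp_rev (d : Dart G) : IsUp (G := G) bags d ∨ IsUp (G := G) bags d.rev := by
  rcases vpar_eq_or_of_adj hD hT2 h2 d.2 with h | h
  · exact Or.inr h
  · exact Or.inl h

/-- Not both darts of an edge point upwards. [folklore] -/
theorem not_isUp_rev {d : Dart G} (h : IsUp (G := G) bags d) : ¬ IsUp (G := G) bags d.rev := by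
  rintro ⟨h1, h2⟩
  have ha := vrk_vpar_lt h.2
  have hb := vrk_vpar_lt h2
  rw [h.1] at ha
  rw [h1] at hb
  simp only [Dart.rev] at hb
  exact lt_asymm ha hb

/-- The dart to the parent points upwards. [folklore] -/
theorem isUp_upDart (w : Fin v) (h : vpar (G := G) bags w ≠ w) : IsUp (G := G) bags (upDart w h) := ⟨rfl, h⟩

/-- **A width-`1` tree decomposition of `G₂`, rooted**, when `G` carries the rooting `vpar`: an
empty root; for every vertex `w` the node `{w, w_{w,π w}}` (or `{w}` for a root of the forest);
for every upward dart `(w, π w)` the node `{w_{w,πw}, w_{πw,w}}`, child of the node of the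
downward dart `(π w, w)`, which carries `{w_{πw,w}, π w}` and is a child of the node of `π w`.
(The paper: "if tw(G) = 1, then G is a tree … then G₂ is a tree too and thus tw(G₂) = tw(G)".)
[cite: ChenFlumLiu2025, §12 (tree decomposition of G₂, case tw(G) = 1)] -/
noncomputable def narrowTD : RankedTD (subdiv G) (Unit ⊕ (Fin v ⊕ Dart G)) := by
  classical
  exact {
  root := .inl ()
  parent := fun i => match i with
    | .inl () => .inl ()
    | .inr (.inl w) => if h : vpar (G := G) bags w ≠ w then .inr (.inr (upDart w h)) else .inl ()
    | .inr (.inr d) => if IsUp (G := G) bags d then .inr (.inr d.rev) else .inr (.inl d.1.1)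
  rank := fun i => match i with
    | .inl () => 0
    | .inr (.inl w) => 3 * vrk bags w + 3
    | .inr (.inr d) => if IsUp (G := G) bags d then 3 * vrk bags d.1.1 + 2 else 3 * vrk bags d.1.2 + 1
  rank_parent_lt := by
    rintro (_ | w | d) hi
    · exact absurd rfl hi
    · by_cases h : vpar (G := G) bags w ≠ w
      · simp only [h, ne_eq, not_false_eq_true, dif_pos, isUp_upDart, if_true]
        show 3 * vrk bags w + 2 < 3 * vrk bags w + 3
        omega
      · simp only [h, dif_neg, not_false_eq_true]
        omega
    · by_cases h : IsUp (G := G) bags d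
      · simp only [h, if_true, not_isUp_rev h, if_false]
        show 3 * vrk bags d.1.1 + 1 < 3 * vrk bags d.1.1 + 2
        omega
      · have h' : IsUp (G := G) bags d.rev := (isUp_or_isUp_rev hD hT2 h2 d).resolve_left h
        simp only [h, if_false]
        have hlt := vrk_vpar_lt h'.2
        rw [h'.1] at hlt
        simp only [Dart.rev] at hlt
        show 3 * vrk bags d.1.1 + 3 < 3 * vrk bags d.1.2 + 1
        omega
  bag := fun i => match i with
    | .inl () => ∅
    | .inr (.inl w) => if h : vpar (G := G) bags w ≠ w then {.inl w, .inr (upDart w h)} else {.inl w}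
    | .inr (.inr d) => if IsUp (G := G) bags d then {.inr d, .inr d.rev} else {.inr d, .inl d.1.1}
  home := fun x => match x with
    | .inl w => .inr (.inl w)
    | .inr d => .inr (.inr d)
  mem_bag_home := by
    rintro (w | d)
    · by_cases h : vpar (G := G) bags w ≠ w
      · simp only [h, ne_eq, not_false_eq_true, dif_pos]; simp
      · simp only [h, dif_neg, not_false_eq_true]; simp
    · by_cases h : IsUp (G := G) bags d <;> simp [h]
  exists_mem_bag_of_adj := by
    rintro (u | d) (u' | d') hadj
    · exact absurd hadj (subdiv_not_adj_inl_inl G u u')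
    · rw [subdiv_adj_inl_inr] at hadj
      subst hadj
      by_cases h : IsUp (G := G) bags d'
      · refine ⟨.inr (.inl d'.1.1), ?_⟩
        have hne : vpar (G := G) bags d'.1.1 ≠ d'.1.1 := h.2
        have heq : upDart d'.1.1 hne = d' := Subtype.ext (Prod.ext rfl h.1)
        simp only [hne, ne_eq, not_false_eq_true, dif_pos]
        rw [heq]; simp
      · exact ⟨.inr (.inr d'), by simp [h]⟩
    · rw [subdiv_adj_inr_inl] at hadj
      subst hadj
      by_cases h : IsUp (G := G) bags d
      · refine ⟨.inr (.inl d.1.1), ?_⟩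
        have hne : vpar (G := G) bags d.1.1 ≠ d.1.1 := h.2
        have heq : upDart d.1.1 hne = d := Subtype.ext (Prod.ext rfl h.1)
        simp only [hne, ne_eq, not_false_eq_true, dif_pos]
        rw [heq]; simp
      · exact ⟨.inr (.inr d), by simp [h]⟩
    · rw [subdiv_adj_inr_inr] at hadj
      subst hadj
      by_cases h : IsUp (G := G) bags d
      · exact ⟨.inr (.inr d), by simp [h]⟩
      · have h' : IsUp (G := G) bags d.rev := (isUp_or_isUp_rev hD hT2 h2 d).resolve_left h
        exact ⟨.inr (.inr d.rev), by simp [h']⟩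
  mem_bag_parent := by
    rintro x (_ | w | d) hx hne
    · simp at hx
    · refine ⟨by simp, ?_⟩
      by_cases h : vpar (G := G) bags w ≠ w
      · simp only [h, ne_eq, not_false_eq_true, dif_pos, Finset.mem_insert, Finset.mem_singleton] at hx ⊢
        rcases hx with rfl | rfl
        · exact absurd rfl hne
        · simp [isUp_upDart]
      · simp only [h, dif_neg, not_false_eq_true, Finset.mem_singleton] at hx
        subst hx
        exact absurd rfl hne
    · refine ⟨by simp, ?_⟩
      by_cases h : IsUp (G := G) bags d
      · simp only [h, if_true, Finset.mem_insert, Finset.mem_singleton] at hx ⊢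
        rcases hx with rfl | rfl
        · exact absurd rfl hne
        · simp [not_isUp_rev h]
      · simp only [h, if_false, Finset.mem_insert, Finset.mem_singleton] at hx ⊢
        rcases hx with rfl | rfl
        · exact absurd rfl hne
        · by_cases h' : vpar (G := G) bags d.1.1 ≠ d.1.1
          · simp only [h', ne_eq, not_false_eq_true, dif_pos]; simp
          · simp only [h', dif_neg, not_false_eq_true]; simp }

/-- The bags of `narrowTD` have at most two vertices. [cite: ChenFlumLiu2025, §12 (case tw(G) = 1)] -/
theorem card_bag_narrowTD_le (i : Unit ⊕ (Fin v ⊕ Dart G)) : ((narrowTD hD hT2 h2).bag i).card ≤ 2 := by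
  classical
  rcases i with _ | w | d
  · show (∅ : Finset (Fin v ⊕ Dart G)).card ≤ 2
    simp
  · show (if h : vpar (G := G) bags w ≠ w then ({.inl w, .inr (upDart w h)} : Finset (Fin v ⊕ Dart G))
      else {.inl w}).card ≤ 2
    split_ifs
    · exact Finset.card_le_two
    · simp
  · show (if IsUp (G := G) bags d then ({.inr d, .inr d.rev} : Finset (Fin v ⊕ Dart G))
      else {.inr d, .inl d.1.1}).card ≤ 2
    split_ifs <;> exact Finset.card_le_two

end Narrow

/-! ### `tw(G₂) ≤ max(tw(G), 1)`: a decomposition of `G₂` with bags of size `≤ k` -/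

section Assembly

open Literature.Combinatorics.SimpleGraph Literature.Combinatorics.SimpleGraph.ListTD

variable {G}

/-- **`G₂` has a tree decomposition with bags of size `≤ k` whenever `tw(G) < k` and `k ≥ 2`**
("Then tw(G₂) = tw(G)", p. 39: the bags `B₁`, `B₂` for `k ≥ 3`, the tree case for `k = 2`).
[cite: ChenFlumLiu2025, §12 (tw(G₂) = tw(G))] -/
theorem exists_treeDecomposition_subdiv [DecidableRel G.Adj] {k : ℕ} (hk : 2 ≤ k) (htw : treewidth G < k) :
    ∃ (ι : Type) (_ : Fintype ι) (_ : DecidableEq ι) (D : TreeDecomposition (subdiv G) ι),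
      ∀ t, (D.bag t).card ≤ k := by
  classical
  obtain ⟨par, bags, hD, hT2, hlen⟩ := exists_listTD (G := G) (k' := k - 1) (by omega)
  have hlen' : ∀ t, t < bags.length → (bagOf bags t).length ≤ k := fun t ht => (hlen t ht).trans (by omega)
  rcases Nat.lt_or_ge k 3 with hk3 | hk3
  · have hk2 : k = 2 := by omega
    subst hk2
    exact ⟨_, inferInstance, inferInstance, (narrowTD hD hT2 hlen').toTreeDecomposition,
      fun t => card_bag_narrowTD_le hD hT2 hlen' t⟩
  · exact ⟨_, inferInstance, inferInstance, (wideTD hD hT2).toTreeDecomposition,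
      fun t => (card_bag_wideTD_le hD hT2 hlen' t).trans (max_le le_rfl hk3)⟩

end Assembly

end ChenFlumLiu2025

/-- **Chen–Flum–Liu 2025, Cor. 12.3, proved**: for `k ≥ 2`, `tw(G) < k` and an edge `e` of `G`,
the uncoloured CFI graphs `Y(G) = cfiEven G` and `Ỹ(G) = cfiGraph G {e}` are not
`C^k`-equivalent. Proof as printed: by Dvořák's theorem in the direction "game ⇒ equal
homomorphism counts from graphs of tree-width `< k`" (`Dvorak2010.card_hom_eq_of_ckEquiv`,
proved in `CkEquivHomCount.lean`) it suffices that the 2-subdivision `G₂`, which has a tree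
decomposition with bags of size `≤ k` (`ChenFlumLiu2025.exists_treeDecomposition_subdiv`), has
`hom(G₂, Ỹ(G)) < hom(G₂, Y(G))` (Thm. 12.2, `ChenFlumLiu2025.card_hom_subdiv_lt`). The
hypotheses "`G` connected" and "`|G| ≥ 2`" of the fact (the paper's standing assumptions) are
not used. [cite: ChenFlumLiu2025, Cor. 12.3 (with Thm. 12.1 = Dvořák and Thm. 12.2)] -/
theorem ChenFlumLiu2025_not_ckEquiv_of_treewidth_lt_holds : ChenFlumLiu2025_not_ckEquiv_of_treewidth_lt := by
  intro v k G _ _ _ hk htw e he _ hequiv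
  classical
  obtain ⟨ι, _, _, D, hD⟩ := ChenFlumLiu2025.exists_treeDecomposition_subdiv hk htw
  have heq := Dvorak2010.card_hom_eq_of_ckEquiv (show 1 ≤ k by omega) hequiv D hD
  have hlt := ChenFlumLiu2025.card_hom_subdiv_lt (G := G) he
  omega

/-! ## Chen–Flum–Liu 2025, Thm. 11.1: if `tw(G) ≥ k`, the uncoloured CFI graphs are `≡_{C^k}`

The second half of this file discharges the other named fact of `CFIUncoloured.lean`,
`ChenFlumLiu2025_ckEquiv_of_le_treewidth` (`ChenFlumLiu2025_ckEquiv_of_le_treewidth_holds`):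
for a connected base graph `G` on `≥ 2` vertices with `1 ≤ k ≤ tw(G)` and an edge `e`,
Duplicator wins the bijective `k`-pebble game on `CFI(G, ∅)` and `CFI(G, {e})`
(`CkEquiv k (cfiEven G) (cfiGraph G {e})`).

We follow the printed proof (Chen–Flum–Liu, arXiv:2507.01459, proof of Thm. 11.1, pp. 36–38):
* **Thm. 11.2 (Seymour–Thomas):** "The Robber has a winning strategy for the `k` cops and robber
  game on `G` iff `tw(G) ≥ k`" — used there as a black box; here it is the tree's
  `Literature.Combinatorics.SimpleGraph.exists_isHaven_of_le_treewidth` (a haven of order `k + 1`,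
  proved in `TreewidthDuality.lean` from the bramble form of the tree-width duality theorem).
* **The strategy** (`ckEquiv_cfiEven_cfiGraph_of_haven`): Duplicator maintains the invariant
  (a)+(b) of the source — the pebbled gadgets are the cops, the Robber sits at `u ∈ β(cops)`, and
  the current position lies on the graph of an isomorphism `X^{uu'}(G) ≅ X^{u₀u₀'}(G)` for an edge
  `uu'` at the Robber's vertex; her bijection `h(x) := (f ∘ g_{p(x)})(x)` ((11.3)) is assembled
  gadget by gadget from the isomorphisms moving the twist along the Robber's escape walks
  (CFI Lemma 6.1/6.2; the tree's `exists_gauge`, `exists_gaugeIso`, `basesOf`,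
  `cfiGraph_adj_congr_of_base` of `CountingWidthParameterProofs.lean`, whose separator version
  `ckEquiv_cfiEven_cfiGraph_of_separator` has the same architecture with the "big component" in
  place of the haven).
The coloured/uncoloured distinction plays no role for this direction ((12.1) of the source:
`X(G) ≡ X̃(G)` implies `Y(G) ≡ Ỹ(G)`; the tree's `cfiGraph` is the uncoloured `Y`).

### References for Thm. 11.1

* [ChenFlumLiu2025] Y. Chen, J. Flum, M. Liu, *Some remarks on the uncolored versions of the
  original CFI-graphs*, arXiv:2507.01459 (2025), Thm. 11.1 (proof, pp. 36–38), Thm. 11.2, (11.3),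
  (12.1). Read via `lit read arxiv:2507.01459`, PDF pp. 51–55.
* [SeymourThomas1993] P. D. Seymour, R. Thomas, J. Combin. Theory Ser. B 58 (1993) 22–33.
* [CaiFurerImmerman1992] J.-Y. Cai, M. Fürer, N. Immerman, Combinatorica 12 (1992), Lemma 6.2.
* A. Dawar, D. Richerby, *The power of counting logics on restricted classes of finite
  structures*, CSL 2007 (the tree-width form for graphs of minimum degree ≥ 2).
-/

section HavenStrategy

variable {v : ℕ} (G : SimpleGraph (Fin v)) [DecidableRel G.Adj]

omit [DecidableRel G.Adj] in
/-- In a connected graph on at least two vertices every vertex has a neighbour. [folklore] -/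
theorem exists_adj_of_connected (hconn : G.Connected) (h2 : 2 ≤ v) (a : Fin v) :
    ∃ b, G.Adj a b := by
  obtain ⟨c, hc⟩ : ∃ c : Fin v, c ≠ a := by
    by_cases ha : (a : ℕ) = 0
    · exact ⟨⟨1, by omega⟩, fun h => by simp [← h] at ha⟩
    · exact ⟨⟨0, by omega⟩, fun h => by simp [← h] at ha⟩
  obtain ⟨W⟩ := hconn.preconnected a c
  cases W with
  | nil => exact (hc rfl).elim
  | cons h _ => exact ⟨_, h⟩

/-- Boolean bookkeeping (first orientation): from the boundary of a marking to the relation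
between the two twist sets it connects. [folklore] -/
private theorem haven_twist_aux₁ {a b : Bool} {P Q : Prop} [Decidable P] [Decidable Q]
    (h : (a ^^ b) = (decide P ^^ decide Q)) : Q ↔ (P ↔ a = b) := by
  by_cases hP : P <;> by_cases hQ : Q <;> cases a <;> cases b <;> simp_all

/-- Boolean bookkeeping (second orientation). [folklore] -/
private theorem haven_twist_aux₂ {a b : Bool} {P Q : Prop} [Decidable P] [Decidable Q]
    (h : (a ^^ b) = (decide P ^^ decide Q)) : P ↔ (Q ↔ a = b) := by
  by_cases hP : P <;> by_cases hQ : Q <;> cases a <;> cases b <;> simp_all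

/-- The WINNING POSITIONS of Duplicator on `CFI(G, ∅)` versus `CFI(G, T₁)` read off a haven `β`
(the Robber's winning strategy in the cops-and-robber game): at most `k` pebble pairs `p`, a
vertex `a` in the haven's flap `β` of the set of pebbled base vertices (the Robber's position,
so no pebble stands on the gadget of `a`), a neighbour `b` of `a`, and a gadget-preserving
isomorphism `φ : CFI(G, {a,b}) ≅ CFI(G, T₁)` whose graph contains `p` — invariant (a)+(b) of the
proof of Chen–Flum–Liu's Thm 11.1 ("the twist sits at an edge `uu'` at the Robber's vertex `u`").
[cite: ChenFlumLiu2025, Thm 11.1 (proof, invariant (a), (b))] -/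
def cfiHavenCarrier (β : Set (Fin v) → Set (Fin v)) (T₁ : Set (Sym2 (Fin v)))
    [DecidablePred (· ∈ T₁)] (k : ℕ) : Set (Set (CFIVertex G × CFIVertex G)) :=
  {p | p.Finite ∧ p.ncard ≤ k ∧ ∃ a b : Fin v, a ∈ β (basesOf G p) ∧ G.Adj a b ∧
      ∃ φ : cfiGraph G ({s(a, b)} : Set (Sym2 (Fin v))) ≃g cfiGraph G T₁,
        (∀ x, cfiBase G (φ x) = cfiBase G x) ∧ ∀ x ∈ p, x.2 = φ x.1}

/-- **From the Robber to the Duplicator (Chen–Flum–Liu 2025, proof of Thm 11.1; Dawar–Richerby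
2007).** Let `G` be connected with at least two vertices and let `β` assign to every set `X` of
at most `k` base vertices a nonempty set `β X` of vertices off `X`, any two of which are joined by
a walk of `G` avoiding `X`, monotonically (`X ⊆ Y ⇒ β Y ⊆ β X`) — a haven of order `k + 1`, i.e. a
winning strategy for the Robber against `k` cops. Then Duplicator wins the bijective `k`-pebble
game on `CFI(G, ∅)` and `CFI(G, T₁)` whenever `T₁ ∩ E(G)` is a single edge: she keeps the twist at
an edge at the Robber's current vertex `a ∈ β(pebbled gadgets)`; when Spoiler announces a pebble,
for every gadget `z` the Robber's answer `a' ∈ β(pebbled ∪ {z})` is reached from `a` by a walk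
avoiding the pebbled gadgets, along which a gauge isomorphism fixing the pebbled gadgets moves the
twist (CFI Lemma 6.2, the tree's `exists_gauge` / `exists_gaugeIso`); Duplicator's bijection is
assembled gadget by gadget from these isomorphisms ((11.3) of the source).
[cite: ChenFlumLiu2025, Thm 11.1 (proof)] -/
theorem ckEquiv_cfiEven_cfiGraph_of_haven {k : ℕ} (hconn : G.Connected) (h2 : 2 ≤ v)
    (β : Set (Fin v) → Set (Fin v))
    (hne : ∀ X : Set (Fin v), X.ncard ≤ k → (β X).Nonempty)
    (hdisj : ∀ X : Set (Fin v), X.ncard ≤ k → ∀ a ∈ β X, a ∉ X)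
    (hwalk : ∀ X : Set (Fin v), X.ncard ≤ k → ∀ a ∈ β X, ∀ a' ∈ β X,
      ∃ W : G.Walk a a', ∀ z ∈ W.support, z ∉ X)
    (hanti : ∀ X Y : Set (Fin v), X ⊆ Y → Y.ncard ≤ k → β Y ⊆ β X)
    {x₁ y₁ : Fin v} (he : G.Adj x₁ y₁) (T₁ : Set (Sym2 (Fin v))) [DecidablePred (· ∈ T₁)]
    (hT₁ : ∀ u w, G.Adj u w → (s(u, w) ∈ T₁ ↔ s(u, w) = s(x₁, y₁))) :
    CkEquiv k (cfiEven G) (cfiGraph G T₁) := by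
  refine ⟨{ carrier := cfiHavenCarrier G β T₁ k
            empty_mem := ?_
            finite_of_mem := fun p hp => hp.1
            ncard_le_of_mem := fun p hp => hp.2.1
            isPartialIso_of_mem := ?_
            mem_of_subset := ?_
            forth := ?_ }⟩
  · -- the initial position: the twist at an edge at the Robber's first vertex, moved from `{x₁,y₁}`
    refine ⟨Set.finite_empty, by simp, ?_⟩
    have h0 : basesOf G (∅ : Set (CFIVertex G × CFIVertex G)) = ∅ := Set.image_empty _
    obtain ⟨a, ha⟩ := hne ∅ (by simp)
    obtain ⟨b, hab⟩ := exists_adj_of_connected G hconn h2 a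
    obtain ⟨W⟩ := hconn.preconnected a x₁
    obtain ⟨g, hg, -, hbd⟩ :=
      exists_gauge (G := G) Set.univ W hab.symm he fun z _ => Set.mem_univ z
    obtain ⟨φ, hφ, -⟩ := exists_gaugeIso (G := G) hg (T := ({s(a, b)} : Set (Sym2 (Fin v))))
      (T' := T₁) fun u w huw => by
        rw [hT₁ u w huw, Set.mem_singleton_iff, Sym2.eq_swap (a := a) (b := b)]
        exact haven_twist_aux₁ (hbd u w huw)
    exact ⟨a, b, h0 ▸ ha, hab, φ, hφ, fun x hx => (Set.notMem_empty x hx).elim⟩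
  · -- winning positions are partial isomorphisms `CFI(G,∅) ⇀ CFI(G,T₁)`
    rintro p ⟨hfin, hcard, a, b, ha, -, φ, -, hφp⟩
    have hpi : IsPartialIso (cfiGraph G ({s(a, b)} : Set (Sym2 (Fin v)))) (cfiGraph G T₁) p :=
      IsPartialIso.of_iso φ hφp
    refine ⟨hpi.eq_iff, fun x hx y hy => ?_⟩
    rw [← hpi.adj_iff hx hy, ← cfiGraph_empty]
    refine cfiGraph_adj_congr_of_base G ?_
    simp only [Set.mem_empty_iff_false, Set.mem_singleton_iff, false_iff]
    intro heq
    have hx' : cfiBase G x.1 ∈ basesOf G p := ⟨x, hx, rfl⟩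
    have hy' : cfiBase G y.1 ∈ basesOf G p := ⟨y, hy, rfl⟩
    have ha' := hdisj _ ((ncard_basesOf_le G hfin).trans hcard) a ha
    rw [Sym2.eq_iff] at heq
    rcases heq with ⟨h1, -⟩ | ⟨-, h1⟩
    · exact ha' (h1 ▸ hx')
    · exact ha' (h1 ▸ hy')
  · -- closure under lifting pebbles: the Robber's flap only grows
    rintro p ⟨hfin, hcard, a, b, ha, hab, φ, hφ, hφp⟩ q hqp
    have hB : basesOf G q ⊆ basesOf G p := basesOf_mono G hqp
    exact ⟨hfin.subset hqp, (Set.ncard_le_ncard hqp hfin).trans hcard, a, b,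
      hanti _ _ hB ((ncard_basesOf_le G hfin).trans hcard) ha, hab, φ, hφ,
      fun x hx => hφp x (hqp hx)⟩
  · -- the bijective forth property
    rintro p ⟨hfin, hcard, a, b, ha, hab, φ, hφ, hφp⟩ hlt
    have hBp : (basesOf G p).ncard ≤ k := (ncard_basesOf_le G hfin).trans hcard
    have key : ∀ z : Fin v, ∃ a' b' : Fin v, a' ∈ β (insert z (basesOf G p)) ∧ G.Adj a' b' ∧
        ∃ ψ : cfiGraph G ({s(a', b')} : Set (Sym2 (Fin v))) ≃g cfiGraph G T₁,
          (∀ x, cfiBase G (ψ x) = cfiBase G x) ∧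
            ∀ x, cfiBase G x ∈ basesOf G p → ψ x = φ x := by
      intro z
      have hBz : (insert z (basesOf G p)).ncard ≤ k := by
        have h₁ := Set.ncard_insert_le z (basesOf G p)
        have h₂ := ncard_basesOf_le G hfin
        omega
      obtain ⟨a', ha'⟩ := hne _ hBz
      obtain ⟨b', hab'⟩ := exists_adj_of_connected G hconn h2 a'
      have hsub : basesOf G p ⊆ insert z (basesOf G p) := Set.subset_insert _ _
      obtain ⟨W, hW⟩ := hwalk _ hBp a ha a' (hanti _ _ hsub hBz ha')
      obtain ⟨g, hg, hgsupp, hbd⟩ :=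
        exists_gauge (G := G) (basesOf G p)ᶜ W hab.symm hab' fun z hz => hW z hz
      obtain ⟨ψ, hψ, hψfix⟩ := exists_gaugeIso (G := G) hg
        (T := ({s(a', b')} : Set (Sym2 (Fin v)))) (T' := ({s(a, b)} : Set (Sym2 (Fin v))))
        fun u w huw => by
          rw [Set.mem_singleton_iff, Set.mem_singleton_iff, Sym2.eq_swap (a := a) (b := b)]
          exact haven_twist_aux₂ (hbd u w huw)
      refine ⟨a', b', ha', hab', ψ.trans φ, fun x => (hφ _).trans (hψ x), fun x hx => ?_⟩
      show φ (ψ x) = φ x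
      rw [hψfix x fun w => hgsupp _ (fun h => h hx) w]
    choose fa fb hfa hfab ψ hψbase hψfix using key
    -- Duplicator's bijection: on the gadget over `z`, play `ψ z`
    have hgen : ∀ (z₁ z₂ : Fin v) (x y : CFIVertex G), z₁ = z₂ → ψ z₁ x = ψ z₂ y → x = y := by
      rintro z₁ _ x y rfl h
      exact (ψ z₁).injective h
    have hFinj : Function.Injective fun x : CFIVertex G => ψ (cfiBase G x) x := by
      intro x y hxy
      refine hgen (cfiBase G x) (cfiBase G y) x y ?_ hxy
      have h := congrArg (cfiBase G) hxy
      simpa only [hψbase] using h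
    refine ⟨Equiv.ofBijective _ (Finite.injective_iff_bijective.1 hFinj), fun x => ?_⟩
    refine ⟨hfin.insert _, (Set.ncard_insert_le _ _).trans (Nat.succ_le_of_lt hlt),
      fa (cfiBase G x), fb (cfiBase G x), ?_, hfab _, ψ (cfiBase G x), hψbase _, ?_⟩
    · rw [basesOf_insert]
      exact hfa _
    · rintro y (rfl | hy)
      · rfl
      · rw [hψfix _ y.1 ⟨y, hy, rfl⟩]
        exact hφp y hy

end HavenStrategy

open Literature.Combinatorics.SimpleGraph

/-- The same with the Robber's strategy packaged as a HAVEN OF ORDER `k + 1`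
(`Literature.Combinatorics.SimpleGraph.IsHaven`, Seymour–Thomas): Duplicator wins the bijective
`k`-pebble game on `CFI(G, ∅)` and `CFI(G, T₁)`, `T₁ ∩ E(G)` a single edge.
[cite: ChenFlumLiu2025, Thm 11.1 (proof)] -/
theorem ckEquiv_cfiEven_cfiGraph_of_isHaven {v k : ℕ} (G : SimpleGraph (Fin v)) [DecidableRel G.Adj]
    (hconn : G.Connected) (h2 : 2 ≤ v) {β : Set (Fin v) → Set (Fin v)} (hβ : IsHaven G (k + 1) β)
    {x₁ y₁ : Fin v} (he : G.Adj x₁ y₁) (T₁ : Set (Sym2 (Fin v))) [DecidablePred (· ∈ T₁)]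
    (hT₁ : ∀ u w, G.Adj u w → (s(u, w) ∈ T₁ ↔ s(u, w) = s(x₁, y₁))) :
    CkEquiv k (cfiEven G) (cfiGraph G T₁) :=
  ckEquiv_cfiEven_cfiGraph_of_haven G hconn h2 β (fun _ hX => hβ.nonempty_of_ncard_le hX)
    (fun _ hX _ ha => hβ.not_mem_of_ncard_le hX ha)
    (fun _ hX _ ha _ hb => hβ.exists_walk_of_ncard_le hX ha hb)
    (fun _ _ hXY hY => hβ.anti_of_ncard_le hXY hY) he T₁ hT₁

/-- **Chen–Flum–Liu 2025, Thm. 11.1 / (12.1), discharged:** for a connected base graph `G` on at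
least two vertices with `tw(G) ≥ k ≥ 1`, the uncoloured CFI graphs `Y(G) = CFI(G, ∅)` and
`Ỹ(G) = CFI(G, {e})` are `C^k`-equivalent. Proof as printed: by the tree-width duality theorem
of Seymour–Thomas (their Thm. 11.2; here `exists_isHaven_of_le_treewidth`, a haven of order
`k + 1` = a winning strategy of the Robber against `k` cops) and the Duplicator strategy read off
the Robber's strategy (`ckEquiv_cfiEven_cfiGraph_of_isHaven`).
[cite: ChenFlumLiu2025, Thm. 11.1 and (12.1)] -/
theorem ChenFlumLiu2025_ckEquiv_of_le_treewidth_holds :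
    ChenFlumLiu2025_ckEquiv_of_le_treewidth := by
  intro v k G _ hconn hv hk htw e
  induction e using Sym2.ind with
  | _ x₁ y₁ =>
    intro he _
    obtain ⟨β, hβ⟩ := exists_isHaven_of_le_treewidth G hk htw
    exact ckEquiv_cfiEven_cfiGraph_of_isHaven G hconn hv hβ
      (by simpa [SimpleGraph.mem_edgeSet] using he) _ fun u w _ => Set.mem_singleton_iff

end Literature.ModelTheory.FiniteModelTheory
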